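import Summits.CriticalPhenomena.PercolationContinuityZ3.Theorems.Transplant.SkelPhiFaceNegBTC3
import Summits.CriticalPhenomena.PercolationContinuityZ3.Theorems.Transplant.SkelNegBParamsBridgeFrameF
import Summits.CriticalPhenomena.PercolationContinuityZ3.Theorems.Transplant.SkelNegBParamsFaceLamA
import Summits.CriticalPhenomena.PercolationContinuityZ3.Theorems.Transplant.SkelPhiRootBridgeData
import Summits.CriticalPhenomena.PercolationContinuityZ3.Theorems.Transplant.SkelNegBParamsB
import Summits.CriticalPhenomena.PercolationContinuityZ3.Theorems.Transplant.SkelPhiRootNegBY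
import Summits.CriticalPhenomena.PercolationContinuityZ3.Theorems.Transplant.SkelNegBParamsFaceA
import Summits.CriticalPhenomena.PercolationContinuityZ3.Theorems.Transplant.SkelNegBParamsSlotsSUA
import Summits.CriticalPhenomena.PercolationContinuityZ3.Theorems.Transplant.SkelNegBParamsResidualsA
import Summits.CriticalPhenomena.PercolationContinuityZ3.Theorems.Transplant.SkelNegBParamsRootA
import Summits.CriticalPhenomena.PercolationContinuityZ3.Theorems.Transplant.SkelNegBParamsKitFloors
import Summits.CriticalPhenomena.PercolationContinuityZ3.Theorems.Transplant.SkelPhiFaceSlots2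
import Summits.CriticalPhenomena.PercolationContinuityZ3.Theorems.Transplant.SkelNegBParamsBridgeF
import Summits.CriticalPhenomena.PercolationContinuityZ3.Theorems.Transplant.SkelNegBParamsSchedA
import Summits.CriticalPhenomena.PercolationContinuityZ3.Theorems.Transplant.SkelPhiRootNegBKit
import Summits.CriticalPhenomena.PercolationContinuityZ3.Theorems.Transplant.SkelPhiVLineServe
import Summits.CriticalPhenomena.PercolationContinuityZ3.Theorems.Transplant.SkelNegBParamsRootK
import Summits.CriticalPhenomena.PercolationContinuityZ3.Theorems.Transplant.SkelNegBParamsSlotsT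
import Summits.CriticalPhenomena.PercolationContinuityZ3.Theorems.Transplant.SkelNegBParamsFaceRoomsA
import Summits.CriticalPhenomena.PercolationContinuityZ3.Theorems.Transplant.SkelNegBParamsFaceLatA
import Summits.CriticalPhenomena.PercolationContinuityZ3.Theorems.Transplant.SkelPhiFaceChainFactL
import Summits.CriticalPhenomena.PercolationContinuityZ3.Theorems.Transplant.SkelNegBParamsLFA
import Summits.CriticalPhenomena.PercolationContinuityZ3.Theorems.Transplant.SkelPhiRootServe
import Summits.CriticalPhenomena.PercolationContinuityZ3.Theorems.Transplant.SkelPhiRootServeTable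
import Summits.CriticalPhenomena.PercolationContinuityZ3.Theorems.Transplant.SkelNegBParamsExcess
import Summits.CriticalPhenomena.PercolationContinuityZ3.Theorems.Transplant.SkelNegBChoiceAllTA
import Summits.CriticalPhenomena.PercolationContinuityZ3.Theorems.Transplant.SkelPhiCylRadOri
import HarnessLib

/-!
# N1 ({±1} node), (F) column — THE WRAPPER'S LAYER (b), part B3, transposed cases (hp-8 g36): `NegB.faceOblRM_negBTC₃d/₃t` — part B2 (`faceOblRM_negBTC₂`)
# at ANY pair slot `Pv := KS.PR 0 Px` listing the wide y′-face pair `(M_BF, n_BF)` of column `cF` (hypothesis `hPx`; `KS.mem_PxF` serves it for stmt-g16's `KS.PxF cF 0`, and a κ-dependent column `cK κ` is served the same way), in the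
# THREE ORIENTATION CASES of the F pair (`O.ori t M_BF n_BF = o_L` / transposed steep `ℓ_BF < 2|h_BF|` / transposed flat), WITH DISCHARGED: the
# bridge family `B := KS.BFs / BFd / BFt` (BridgeFrameF p321217: `BF_ok`, `BF_R'_ge`, `hB0_F`, `core1LoF_l1` + `YbF_le_exA` (reach `hπ1` below `L′`),
# `hclr₁_BF` under the face floor `16·S_F ≤ M_L`), its level-box widths and reach (`rootKit_levels/_reach`), its pieces at every centre
# (`Skelφ.bridgeData_same/trSide/trTop` fed by the served Step-I″ inputs of the F pair `inputsExtraAt_of_atQOB` ∘ `KS.mem_PxF`, the F pair's clause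
# `KS.clauseB_of_factsO` for `ℓ_BF ≥ 27`, `|h_BF| ≤ 10 n_BF`, the layer inequality), the F-Λ block (FaceLamA p320758: `Λ_i := KS.ΛF_i`, `kA i := KS.kF_iA`,
# `hΛR_F`, `hΛQ_F`, `hkF0_RA/hkF1_RA`; the zone bound from `M_u ≤ e_F`), and the long numbers' three proofs (`one_le_nL_of_atQOS`, `abs_vL_le_of_atQOS`,
# `layer_of_atQOS`).  LEFT (the glue's inputs): the per-centre numbers `numsX numsY hnFx hnFy` (= `numsX_provider₂/numsY_provider₂` ∘ p3-g12's
# FaceFloorsXA/YA), the hop-side/width choices `σhF hσhF qB qB₃`, and `hCF hmx hex hSF16`.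
builds on p205010 (kernel theorem, internal audit signed; external expert review pending) — nothing in this file uses p205010; no claim about the open node.
Lane `prim-bschramm`, seat `prim-hp-8` (gen 36); helper file (`--supports stmt-CriticalPhenomena-4575 --as helper`); generated by HOME prim-hp-8/code/gen36/gen_btb3.py (second output).
* **`NegB.faceOblRM_negBTC₃d`**, **`NegB.faceOblRM_negBTC₃t`** (case `s` and `faceLam_zone` are in SkelPhiFaceNegBTC3).
[cite: KozmaNitzan2024, §4 Lemma 10 (pp. 17–21), Lemma 12 (pp. 23–25), Theorem 6 (pp. 25–31)] [cite: MartineauTassion2017, §4.3 Lemma 4.2]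
v9 note: v9 (hp-8 g36, 2026-08-22 09:15Z): the y′-face numbers and kit rooms read their OWN half-widths `qB′ qB₃′` (level-units landing half-width, α-units x-run start half-width) — v8 shared `qB qB₃` with the x-face (α-units landing, level-units y′-run start `≥ W ≈ n_Lℓ_L/U`), a units mismatch that breaks the y′-face floors FT5/FT6/FL1/FL2 when `ℓ_L ≫ Kq·n_L`.
-/

noncomputable section

open scoped Classical ENNReal

namespace Summit.CriticalPhenomena.PercolationContinuityZ3.Theorems.Transplant

namespace PlanarSkeletonNeg

namespace NegB

open MeasureTheory Literature.Probability.Percolation Literature.Probability.LatticeModels SimpleGraph KNCells KNLevels GadgetSystem Contour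
open Literature.Probability.Percolation.KozmaNitzan
open Literature.Probability.Percolation.KozmaNitzan.Cells (oth sgOf sgOf_sign stepVec_apply_fst)
open Literature.Barriers.CriticalPhenomena (graphBall mem_graphBall_self graphBall_mono)
open BoxProdZ2 (ConcRadiiG Erad Frad nQ nS)
open ChainPlanar ChainPara
open Skel (winGraph routeW excess WinStepData)
open SkelI (tanOff)
open TwoAxis.Para (modulus detD rep₂)
open SkelConc (Consts)
open Skelφ
open Neg
open Skelφ (oriφ trφ pgramPrismFin pgSideHalfW pgTopPieceW)

variable {κ : Consts} {V : Type} [DecidableEq V] [Countable V] {G : SimpleGraph V} [G.LocallyFinite] {Φ : PlanarSkeletonNeg G} {t : V}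
  {p : unitInterval} {gv fv : Neg.FSlot} {Sv : SSlot} {hC : Φ.CylSubcritical p} {Pv : PSlot} {O : Skelφ.StepI.OutO V} {q : unitInterval}

set_option maxHeartbeats 1600000 in
/-- **Layer (b), part B3 of the (F) wrapper, case `o_F ≠ o_L`, bridge = a side half of `trφ φL` (the steep side condition `ℓ_F < 2|h_F|` is read only by the floors, not here)** (see the module docstring). [cite: KozmaNitzan2024, §4 Lemma 10 (pp. 17–21), Lemma 12 (pp. 23–25)] -/
theorem faceOblRM_negBTC₃d (cF : ℕ) (gx fx : Neg.FSlot) (Px : PSlot) (ex mx : GSlot)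
    (hAt : (choiceAtOTA κ Φ t p (KS.gT 0 gx) (KS.fT 0 fx) (SUA ex mx) hC (KS.PR 0 Px)).AtQO O q)
    (hmx : (prFA κ Φ t p O.merged (gOf κ Φ t p O (KS.gT 0 gx)) (fOf κ Φ t p O (KS.fT 0 fx))).mF (fcellsA κ Φ t p O.merged (gOf κ Φ t p O (KS.gT 0 gx)) (fOf κ Φ t p O (KS.fT 0 fx))) ≤ ((mx κ Φ t p O.merged (gOf κ Φ t p O (KS.gT 0 gx)) (fOf κ Φ t p O (KS.fT 0 fx)) : ℕ) : ℤ))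
    (hex : exA κ Φ t p O.merged (gOf κ Φ t p O (KS.gT 0 gx)) (fOf κ Φ t p O (KS.fT 0 fx)) ≤ ex κ Φ t p O.merged (gOf κ Φ t p O (KS.gT 0 gx)) (fOf κ Φ t p O (KS.fT 0 fx)) ∧
      KS.r₀A Φ t O.merged 0 (O.merged.R (O.merged.scale t (KS.MBF κ Φ t p O.merged cF 0) (KS.nBF κ Φ t p O.merged cF 0))) + 1 ≤ ex κ Φ t p O.merged (gOf κ Φ t p O (KS.gT 0 gx)) (fOf κ Φ t p O (KS.fT 0 fx)))
    (hSF16 : 16 * KS.SF κ Φ t p O.merged cF 0 ≤ ML κ Φ t p O.merged (gOf κ Φ t p O (KS.gT 0 gx)))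
    (hPx : (KS.MBF κ Φ t p O.merged cF 0, KS.nBF κ Φ t p O.merged cF 0) ∈ (KS.PR 0 Px κ Φ t p O.merged).1)
    (htr : oriφ Φ.φ (O.ori t (KS.MBF κ Φ t p O.merged cF 0) (KS.nBF κ Φ t p O.merged cF 0)) = trφ (φL κ Φ t p O.D O.DT O.ori (gOf κ Φ t p O (KS.gT 0 gx)) (fOf κ Φ t p O (KS.fT 0 fx))))(h1 : Φ.types = {t}) (hp0 : 0 < (p : ℝ)) (hp1 : (p : ℝ) < 1)
      (σhF : MDir → ℤ) (hσhF : ∀ du : MDir, σhF du = 1 ∨ σhF du = -1)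
     (qB qB₃ qB' qB₃' : ℕ)
       (hCF : ChainFactL NegB.LfA G Φ.Δ κ)
    (numsX : ∀ (a' : ℕ) (x : Site 2) (du : MDir) (j : ℕ) (pc : ℤ) (c' : V), du.1 = 0 → j < (fcellsA κ Φ t p O.merged (gOf κ Φ t p O (KS.gT 0 gx)) (fOf κ Φ t p O (KS.fT 0 fx))).K → ∀ yF : V,
      (prFA κ Φ t p O.merged (gOf κ Φ t p O (KS.gT 0 gx)) (fOf κ Φ t p O (KS.fT 0 fx))).ψ (φL κ Φ t p O.D O.DT O.ori (gOf κ Φ t p O (KS.gT 0 gx)) (fOf κ Φ t p O (KS.fT 0 fx))) t yF = (fcellsA κ Φ t p O.merged (gOf κ Φ t p O (KS.gT 0 gx)) (fOf κ Φ t p O (KS.fT 0 fx))).faceCen x du j → pc = relφ (φL κ Φ t p O.D O.DT O.ori (gOf κ Φ t p O (KS.gT 0 gx)) (fOf κ Φ t p O (KS.fT 0 fx))) t yF ((prFA κ Φ t p O.merged (gOf κ Φ t p O (KS.gT 0 gx)) (fOf κ Φ t p O (KS.fT 0 fx))).bOf du.1) →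
      (prFA κ Φ t p O.merged (gOf κ Φ t p O (KS.gT 0 gx)) (fOf κ Φ t p O (KS.fT 0 fx))).frame (φL κ Φ t p O.D O.DT O.ori (gOf κ Φ t p O (KS.gT 0 gx)) (fOf κ Φ t p O (KS.fT 0 fx))) t du.1 ((prFA κ Φ t p O.merged (gOf κ Φ t p O (KS.gT 0 gx)) (fOf κ Φ t p O (KS.fT 0 fx))).bOf du.1) c' ∈ Finset.Icc (loN (fcellsA κ Φ t p O.merged (gOf κ Φ t p O (KS.gT 0 gx)) (fOf κ Φ t p O (KS.fT 0 fx))) x du j pc ((fun du : MDir => ((prFA κ Φ t p O.merged (gOf κ Φ t p O (KS.gT 0 gx)) (fOf κ Φ t p O (KS.fT 0 fx))).awF₂ (fcellsA κ Φ t p O.merged (gOf κ Φ t p O (KS.gT 0 gx)) (fOf κ Φ t p O (KS.fT 0 fx))) du).toNat) du) - (((KS.RlevA κ Φ t p O.merged 0 + KS.reachA t O.merged 0) : ℕ) : Site 2)) (hiN (fcellsA κ Φ t p O.merged (gOf κ Φ t p O (KS.gT 0 gx)) (fOf κ Φ t p O (KS.fT 0 fx))) x du j pc ((fun du : MDir =>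 ((prFA κ Φ t p O.merged (gOf κ Φ t p O (KS.gT 0 gx)) (fOf κ Φ t p O (KS.fT 0 fx))).awF₂ (fcellsA κ Φ t p O.merged (gOf κ Φ t p O (KS.gT 0 gx)) (fOf κ Φ t p O (KS.fT 0 fx))) du).toNat) du) + (((KS.RlevA κ Φ t p O.merged 0 + KS.reachA t O.merged 0) : ℕ) : Site 2)) →
      c' ∈ graphBall G t ((concRadii2N (fcellsA κ Φ t p O.merged (gOf κ Φ t p O (KS.gT 0 gx)) (fOf κ Φ t p O (KS.fT 0 fx))) (Skelφ.Prm.gap ((SUA ex mx) κ Φ t p O.merged (gOf κ Φ t p O (KS.gT 0 gx)) (fOf κ Φ t p O (KS.fT 0 fx)) q)) (fun _ : ℕ => (0:ℕ)) (Skelφ.Prm.E₀ ((SUA ex mx) κ Φ t p O.merged (gOf κ Φ t p O (KS.gT 0 gx)) (fOf κ Φ t p O (KS.fT 0 fx)) q)) (Skelφ.Prm.Lp ((SUA ex mx) κ Φ t p O.merged (gOf κ Φ t p O (KS.gT 0 gx)) (fOf κ Φ t p O (KS.fT 0 fx)) q)) (offNA κ Φ t p O.merged (gOf κ Φ t p O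 (KS.gT 0 gx)) (fOf κ Φ t p O (KS.fT 0 fx)))).rE a' x du - (Skelφ.Prm.Lp (SUA ex mx κ Φ t p O.merged (gOf κ Φ t p O (KS.gT 0 gx)) (fOf κ Φ t p O (KS.fT 0 fx)) q))) →
      (Skelφ.Prm.Lp ((SUA ex mx) κ Φ t p O.merged (gOf κ Φ t p O (KS.gT 0 gx)) (fOf κ Φ t p O (KS.fT 0 fx)) q)) ≤ (concRadii2N (fcellsA κ Φ t p O.merged (gOf κ Φ t p O (KS.gT 0 gx)) (fOf κ Φ t p O (KS.fT 0 fx))) (Skelφ.Prm.gap ((SUA ex mx) κ Φ t p O.merged (gOf κ Φ t p O (KS.gT 0 gx)) (fOf κ Φ t p O (KS.fT 0 fx)) q)) (fun _ : ℕ => (0:ℕ)) (Skelφ.Prm.E₀ ((SUA ex mx) κ Φ t p O.merged (gOf κ Φ t p O (KS.gT 0 gx)) (fOf κ Φ t p O (KS.fT 0 fx)) q)) (Skelφ.Prm.Lp ((SUA ex mx) κ Φ t p O.merged (gOf κ Φ t p O (KS.gT 0 gx)) (fOf κ Φ t p O (KS.fT 0 fx)) q)) (offNA κ Φ t p O.merged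 (gOf κ Φ t p O (KS.gT 0 gx)) (fOf κ Φ t p O (KS.fT 0 fx)))).rM a' (x + stepVec du) → (Skelφ.Prm.Lp (SUA ex mx κ Φ t p O.merged (gOf κ Φ t p O (KS.gT 0 gx)) (fOf κ Φ t p O (KS.fT 0 fx)) q)) ≤ (concRadii2N (fcellsA κ Φ t p O.merged (gOf κ Φ t p O (KS.gT 0 gx)) (fOf κ Φ t p O (KS.fT 0 fx))) (Skelφ.Prm.gap ((SUA ex mx) κ Φ t p O.merged (gOf κ Φ t p O (KS.gT 0 gx)) (fOf κ Φ t p O (KS.fT 0 fx)) q)) (fun _ : ℕ => (0:ℕ)) (Skelφ.Prm.E₀ ((SUA ex mx) κ Φ t p O.merged (gOf κ Φ t p O (KS.gT 0 gx)) (fOf κ Φ t p O (KS.fT 0 fx)) q)) (Skelφ.Prm.Lp ((SUA ex mx) κ Φ t p O.merged (gOf κ Φ t p O (KS.gT 0 gx)) (fOf κ Φ t p O (KS.fT 0 fx)) q)) (offNA κ Φ t p O.merged (gOf κ Φ t p O (KS.gT 0 gx)) (fOf κ Φ t p O (KS.fT 0 fx)))).rE a' x du →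
      FaceRunNumsX4 G (φL κ Φ t p O.D O.DT O.ori (gOf κ Φ t p O (KS.gT 0 gx)) (fOf κ Φ t p O (KS.fT 0 fx))) ((prFA κ Φ t p O.merged (gOf κ Φ t p O (KS.gT 0 gx)) (fOf κ Φ t p O (KS.fT 0 fx))).ψ (φL κ Φ t p O.D O.DT O.ori (gOf κ Φ t p O (KS.gT 0 gx)) (fOf κ Φ t p O (KS.fT 0 fx))) t) c' (prFA κ Φ t p O.merged (gOf κ Φ t p O (KS.gT 0 gx)) (fOf κ Φ t p O (KS.fT 0 fx))).A (nL κ Φ t p O.merged (gOf κ Φ t p O (KS.gT 0 gx)) (fOf κ Φ t p O (KS.fT 0 fx))) (prFA κ Φ t p O.merged (gOf κ Φ t p O (KS.gT 0 gx)) (fOf κ Φ t p O (KS.fT 0 fx))).h (prFA κ Φ t p O.merged (gOf κ Φ t p O (KS.gT 0 gx)) (fOf κ Φ t p O (KS.fT 0 fx))).vα (prFA κ Φ t p O.merged (gOf κ Φ t p O (KS.gT 0 gx)) (fOf κ Φ t p O (KS.fT 0 fx))).vβ (prFA κ Φ t p O.merged (gOf κ Φ t p O (KS.gT 0 gx)) (fOf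 κ Φ t p O (KS.fT 0 fx))).c₀ (prFA κ Φ t p O.merged (gOf κ Φ t p O (KS.gT 0 gx)) (fOf κ Φ t p O (KS.fT 0 fx))).c₁ (prFA κ Φ t p O.merged (gOf κ Φ t p O (KS.gT 0 gx)) (fOf κ Φ t p O (KS.fT 0 fx))).D du (sgOf du) ((fun σ' : ℤ => KS.BFd κ Φ t p O.merged cF 0 (gOf κ Φ t p O (KS.gT 0 gx)) (fOf κ Φ t p O (KS.fT 0 fx)) σ') (sgOf du)) (ℓL κ Φ t p O.merged (gOf κ Φ t p O (KS.gT 0 gx)) (fOf κ Φ t p O (KS.fT 0 fx))) (KS.RA' κ Φ t p O.merged 0) qB (KS.RA' κ Φ t p O.merged 0) qB₃ (prFA κ Φ t p O.merged (gOf κ Φ t p O (KS.gT 0 gx)) (fOf κ Φ t p O (KS.fT 0 fx))).vα (one_le_nL_of_atQOS (atQOS_of_atQOTA hAt)) (abs_vL_le_of_atQOS (atQOS_of_atQOTA hAt)) (layer_of_atQOS (atQOS_of_atQOTA hAt)) (Mu O.merged)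
        ((fcellsA κ Φ t p O.merged (gOf κ Φ t p O (KS.gT 0 gx)) (fOf κ Φ t p O (KS.fT 0 fx))).farCore x du j (3 : ℤ)) (targetMM G (φL κ Φ t p O.D O.DT O.ori (gOf κ Φ t p O (KS.gT 0 gx)) (fOf κ Φ t p O (KS.fT 0 fx))) (prFA κ Φ t p O.merged (gOf κ Φ t p O (KS.gT 0 gx)) (fOf κ Φ t p O (KS.fT 0 fx))) (fcellsA κ Φ t p O.merged (gOf κ Φ t p O (KS.gT 0 gx)) (fOf κ Φ t p O (KS.fT 0 fx))) t (concRadii2N (fcellsA κ Φ t p O.merged (gOf κ Φ t p O (KS.gT 0 gx)) (fOf κ Φ t p O (KS.fT 0 fx))) (Skelφ.Prm.gap ((SUA ex mx) κ Φ t p O.merged (gOf κ Φ t p O (KS.gT 0 gx)) (fOf κ Φ t p O (KS.fT 0 fx)) q)) (fun _ : ℕ => (0:ℕ)) (Skelφ.Prm.E₀ ((SUA ex mx) κ Φ t p O.merged (gOf κ Φ t p O (KS.gT 0 gx)) (fOf κ Φ t p O (KS.fT 0 fx)) q)) (Skelφ.Prm.Lp ((SUA ex mx) κ Φ t p O.merged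 (gOf κ Φ t p O (KS.gT 0 gx)) (fOf κ Φ t p O (KS.fT 0 fx)) q)) (offNA κ Φ t p O.merged (gOf κ Φ t p O (KS.gT 0 gx)) (fOf κ Φ t p O (KS.fT 0 fx)))) (b0TA κ Φ t p O.merged (gOf κ Φ t p O (KS.gT 0 gx)) (fOf κ Φ t p O (KS.fT 0 fx))) a' x du (Skelφ.Prm.Lp ((SUA ex mx) κ Φ t p O.merged (gOf κ Φ t p O (KS.gT 0 gx)) (fOf κ Φ t p O (KS.fT 0 fx)) q))) (O.merged.Λ c' (Mu O.merged)) (Skelφ.Prm.Lp (SUA ex mx κ Φ t p O.merged (gOf κ Φ t p O (KS.gT 0 gx)) (fOf κ Φ t p O (KS.fT 0 fx)) q)) ((fun i : Fin 2 => if i = 0 then KS.kF₀A κ Φ t p O.merged cF 0 (gOf κ Φ t p O (KS.gT 0 gx)) (fOf κ Φ t p O (KS.fT 0 fx)) else KS.kF₁A κ Φ t p O.merged cF 0 (gOf κ Φ t p O (KS.gT 0 gx)) (fOf κ Φ t p O (KS.fT 0 fx))) du.1) ((fun i : Fin 2 => if i = 0 then KS.kF₀A κ Φ t p O.merged cF 0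 (gOf κ Φ t p O (KS.gT 0 gx)) (fOf κ Φ t p O (KS.fT 0 fx)) else KS.kF₁A κ Φ t p O.merged cF 0 (gOf κ Φ t p O (KS.gT 0 gx)) (fOf κ Φ t p O (KS.fT 0 fx))) (oth du.1)))
    (numsY : ∀ (a' : ℕ) (x : Site 2) (du : MDir) (j : ℕ) (pc : ℤ) (c' : V), du.1 = 1 → j < (fcellsA κ Φ t p O.merged (gOf κ Φ t p O (KS.gT 0 gx)) (fOf κ Φ t p O (KS.fT 0 fx))).K → ∀ yF : V,
      (prFA κ Φ t p O.merged (gOf κ Φ t p O (KS.gT 0 gx)) (fOf κ Φ t p O (KS.fT 0 fx))).ψ (φL κ Φ t p O.D O.DT O.ori (gOf κ Φ t p O (KS.gT 0 gx)) (fOf κ Φ t p O (KS.fT 0 fx))) t yF = (fcellsA κ Φ t p O.merged (gOf κ Φ t p O (KS.gT 0 gx)) (fOf κ Φ t p O (KS.fT 0 fx))).faceCen x du j → pc = relφ (φL κ Φ t p O.D O.DT O.ori (gOf κ Φ t p O (KS.gT 0 gx)) (fOf κ Φ t p O (KS.fT 0 fx))) t yF ((prFA κ Φ t p O.merged (gOf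 κ Φ t p O (KS.gT 0 gx)) (fOf κ Φ t p O (KS.fT 0 fx))).bOf du.1) →
      (prFA κ Φ t p O.merged (gOf κ Φ t p O (KS.gT 0 gx)) (fOf κ Φ t p O (KS.fT 0 fx))).frame (φL κ Φ t p O.D O.DT O.ori (gOf κ Φ t p O (KS.gT 0 gx)) (fOf κ Φ t p O (KS.fT 0 fx))) t du.1 ((prFA κ Φ t p O.merged (gOf κ Φ t p O (KS.gT 0 gx)) (fOf κ Φ t p O (KS.fT 0 fx))).bOf du.1) c' ∈ Finset.Icc (loN (fcellsA κ Φ t p O.merged (gOf κ Φ t p O (KS.gT 0 gx)) (fOf κ Φ t p O (KS.fT 0 fx))) x du j pc ((fun du : MDir => ((prFA κ Φ t p O.merged (gOf κ Φ t p O (KS.gT 0 gx)) (fOf κ Φ t p O (KS.fT 0 fx))).awF₂ (fcellsA κ Φ t p O.merged (gOf κ Φ t p O (KS.gT 0 gx)) (fOf κ Φ t p O (KS.fT 0 fx))) du).toNat) du) - (((KS.RlevA κ Φ t p O.merged 0 + KS.reachA t O.merged 0) : ℕ) : Site 2)) (hiN (fcellsA κ Φ t p O.merged (gOf κ Φ t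 p O (KS.gT 0 gx)) (fOf κ Φ t p O (KS.fT 0 fx))) x du j pc ((fun du : MDir => ((prFA κ Φ t p O.merged (gOf κ Φ t p O (KS.gT 0 gx)) (fOf κ Φ t p O (KS.fT 0 fx))).awF₂ (fcellsA κ Φ t p O.merged (gOf κ Φ t p O (KS.gT 0 gx)) (fOf κ Φ t p O (KS.fT 0 fx))) du).toNat) du) + (((KS.RlevA κ Φ t p O.merged 0 + KS.reachA t O.merged 0) : ℕ) : Site 2)) →
      c' ∈ graphBall G t ((concRadii2N (fcellsA κ Φ t p O.merged (gOf κ Φ t p O (KS.gT 0 gx)) (fOf κ Φ t p O (KS.fT 0 fx))) (Skelφ.Prm.gap ((SUA ex mx) κ Φ t p O.merged (gOf κ Φ t p O (KS.gT 0 gx)) (fOf κ Φ t p O (KS.fT 0 fx)) q)) (fun _ : ℕ => (0:ℕ)) (Skelφ.Prm.E₀ ((SUA ex mx) κ Φ t p O.merged (gOf κ Φ t p O (KS.gT 0 gx)) (fOf κ Φ t p O (KS.fT 0 fx)) q)) (Skelφ.Prm.Lp ((SUA ex mx) κ Φ t p O.merged (gOf κ Φ t p O (KS.gT 0 gx)) (fOf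 κ Φ t p O (KS.fT 0 fx)) q)) (offNA κ Φ t p O.merged (gOf κ Φ t p O (KS.gT 0 gx)) (fOf κ Φ t p O (KS.fT 0 fx)))).rE a' x du - (Skelφ.Prm.Lp (SUA ex mx κ Φ t p O.merged (gOf κ Φ t p O (KS.gT 0 gx)) (fOf κ Φ t p O (KS.fT 0 fx)) q))) →
      (Skelφ.Prm.Lp ((SUA ex mx) κ Φ t p O.merged (gOf κ Φ t p O (KS.gT 0 gx)) (fOf κ Φ t p O (KS.fT 0 fx)) q)) ≤ (concRadii2N (fcellsA κ Φ t p O.merged (gOf κ Φ t p O (KS.gT 0 gx)) (fOf κ Φ t p O (KS.fT 0 fx))) (Skelφ.Prm.gap ((SUA ex mx) κ Φ t p O.merged (gOf κ Φ t p O (KS.gT 0 gx)) (fOf κ Φ t p O (KS.fT 0 fx)) q)) (fun _ : ℕ => (0:ℕ)) (Skelφ.Prm.E₀ ((SUA ex mx) κ Φ t p O.merged (gOf κ Φ t p O (KS.gT 0 gx)) (fOf κ Φ t p O (KS.fT 0 fx)) q)) (Skelφ.Prm.Lp ((SUA ex mx) κ Φ t p O.merged (gOf κ Φ t p O (KS.gT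 0 gx)) (fOf κ Φ t p O (KS.fT 0 fx)) q)) (offNA κ Φ t p O.merged (gOf κ Φ t p O (KS.gT 0 gx)) (fOf κ Φ t p O (KS.fT 0 fx)))).rM a' (x + stepVec du) → (Skelφ.Prm.Lp (SUA ex mx κ Φ t p O.merged (gOf κ Φ t p O (KS.gT 0 gx)) (fOf κ Φ t p O (KS.fT 0 fx)) q)) ≤ (concRadii2N (fcellsA κ Φ t p O.merged (gOf κ Φ t p O (KS.gT 0 gx)) (fOf κ Φ t p O (KS.fT 0 fx))) (Skelφ.Prm.gap ((SUA ex mx) κ Φ t p O.merged (gOf κ Φ t p O (KS.gT 0 gx)) (fOf κ Φ t p O (KS.fT 0 fx)) q)) (fun _ : ℕ => (0:ℕ)) (Skelφ.Prm.E₀ ((SUA ex mx) κ Φ t p O.merged (gOf κ Φ t p O (KS.gT 0 gx)) (fOf κ Φ t p O (KS.fT 0 fx)) q)) (Skelφ.Prm.Lp ((SUA ex mx) κ Φ t p O.merged (gOf κ Φ t p O (KS.gT 0 gx)) (fOf κ Φ t p O (KS.fT 0 fx)) q)) (offNA κ Φ t p O.merged (gOf κ Φ t p O (KS.gT 0 gx))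 (fOf κ Φ t p O (KS.fT 0 fx)))).rE a' x du →
      FaceRunNumsY4 G (φL κ Φ t p O.D O.DT O.ori (gOf κ Φ t p O (KS.gT 0 gx)) (fOf κ Φ t p O (KS.fT 0 fx))) ((prFA κ Φ t p O.merged (gOf κ Φ t p O (KS.gT 0 gx)) (fOf κ Φ t p O (KS.fT 0 fx))).ψ (φL κ Φ t p O.D O.DT O.ori (gOf κ Φ t p O (KS.gT 0 gx)) (fOf κ Φ t p O (KS.fT 0 fx))) t) c' (prFA κ Φ t p O.merged (gOf κ Φ t p O (KS.gT 0 gx)) (fOf κ Φ t p O (KS.fT 0 fx))).A (nL κ Φ t p O.merged (gOf κ Φ t p O (KS.gT 0 gx)) (fOf κ Φ t p O (KS.fT 0 fx))) (prFA κ Φ t p O.merged (gOf κ Φ t p O (KS.gT 0 gx)) (fOf κ Φ t p O (KS.fT 0 fx))).h (prFA κ Φ t p O.merged (gOf κ Φ t p O (KS.gT 0 gx)) (fOf κ Φ t p O (KS.fT 0 fx))).vα (prFA κ Φ t p O.merged (gOf κ Φ t p O (KS.gT 0 gx)) (fOf κ Φ t p O (KS.fT 0 fx))).vβ (prFA κ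 Φ t p O.merged (gOf κ Φ t p O (KS.gT 0 gx)) (fOf κ Φ t p O (KS.fT 0 fx))).c₀ (prFA κ Φ t p O.merged (gOf κ Φ t p O (KS.gT 0 gx)) (fOf κ Φ t p O (KS.fT 0 fx))).c₁ (prFA κ Φ t p O.merged (gOf κ Φ t p O (KS.gT 0 gx)) (fOf κ Φ t p O (KS.fT 0 fx))).D du (σhF du) (sgOf du) ((fun σ' : ℤ => KS.BFd κ Φ t p O.merged cF 0 (gOf κ Φ t p O (KS.gT 0 gx)) (fOf κ Φ t p O (KS.fT 0 fx)) σ') (σhF du)) (ℓL κ Φ t p O.merged (gOf κ Φ t p O (KS.gT 0 gx)) (fOf κ Φ t p O (KS.fT 0 fx))) (KS.RA' κ Φ t p O.merged 0) qB' (KS.RA' κ Φ t p O.merged 0) qB₃' (prFA κ Φ t p O.merged (gOf κ Φ t p O (KS.gT 0 gx)) (fOf κ Φ t p O (KS.fT 0 fx))).vα (one_le_nL_of_atQOS (atQOS_of_atQOTA hAt)) (abs_vL_le_of_atQOS (atQOS_of_atQOTA hAt))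
        (layer_of_atQOS (atQOS_of_atQOTA hAt)) (Mu O.merged) ((fcellsA κ Φ t p O.merged (gOf κ Φ t p O (KS.gT 0 gx)) (fOf κ Φ t p O (KS.fT 0 fx))).farCore x du j (3 : ℤ)) (targetMM G (φL κ Φ t p O.D O.DT O.ori (gOf κ Φ t p O (KS.gT 0 gx)) (fOf κ Φ t p O (KS.fT 0 fx))) (prFA κ Φ t p O.merged (gOf κ Φ t p O (KS.gT 0 gx)) (fOf κ Φ t p O (KS.fT 0 fx))) (fcellsA κ Φ t p O.merged (gOf κ Φ t p O (KS.gT 0 gx)) (fOf κ Φ t p O (KS.fT 0 fx))) t (concRadii2N (fcellsA κ Φ t p O.merged (gOf κ Φ t p O (KS.gT 0 gx)) (fOf κ Φ t p O (KS.fT 0 fx))) (Skelφ.Prm.gap ((SUA ex mx) κ Φ t p O.merged (gOf κ Φ t p O (KS.gT 0 gx)) (fOf κ Φ t p O (KS.fT 0 fx)) q)) (fun _ : ℕ => (0:ℕ)) (Skelφ.Prm.E₀ ((SUA ex mx) κ Φ t p O.merged (gOf κ Φ t p O (KS.gT 0 gx)) (fOf κ Φ t p O (KS.fT 0 fx)) q))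 (Skelφ.Prm.Lp ((SUA ex mx) κ Φ t p O.merged (gOf κ Φ t p O (KS.gT 0 gx)) (fOf κ Φ t p O (KS.fT 0 fx)) q)) (offNA κ Φ t p O.merged (gOf κ Φ t p O (KS.gT 0 gx)) (fOf κ Φ t p O (KS.fT 0 fx)))) (b0TA κ Φ t p O.merged (gOf κ Φ t p O (KS.gT 0 gx)) (fOf κ Φ t p O (KS.fT 0 fx))) a' x du (Skelφ.Prm.Lp ((SUA ex mx) κ Φ t p O.merged (gOf κ Φ t p O (KS.gT 0 gx)) (fOf κ Φ t p O (KS.fT 0 fx)) q))) (O.merged.Λ c' (Mu O.merged)) (Skelφ.Prm.Lp (SUA ex mx κ Φ t p O.merged (gOf κ Φ t p O (KS.gT 0 gx)) (fOf κ Φ t p O (KS.fT 0 fx)) q)) ((fun i : Fin 2 => if i = 0 then KS.kF₀A κ Φ t p O.merged cF 0 (gOf κ Φ t p O (KS.gT 0 gx)) (fOf κ Φ t p O (KS.fT 0 fx)) else KS.kF₁A κ Φ t p O.merged cF 0 (gOf κ Φ t p O (KS.gT 0 gx)) (fOf κ Φ t p O (KS.fT 0 fx))) du.1) ((fun i : Fin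 2 => if i = 0 then KS.kF₀A κ Φ t p O.merged cF 0 (gOf κ Φ t p O (KS.gT 0 gx)) (fOf κ Φ t p O (KS.fT 0 fx)) else KS.kF₁A κ Φ t p O.merged cF 0 (gOf κ Φ t p O (KS.gT 0 gx)) (fOf κ Φ t p O (KS.fT 0 fx))) (oth du.1)))
    (hnFx : ∀ (a' : ℕ) (x : Site 2) (du : MDir) (j : ℕ) (pc : ℤ) (c' : V) (hI : du.1 = 0) (hj : j < (fcellsA κ Φ t p O.merged (gOf κ Φ t p O (KS.gT 0 gx)) (fOf κ Φ t p O (KS.fT 0 fx))).K) (yF : V)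
      (hyF : (prFA κ Φ t p O.merged (gOf κ Φ t p O (KS.gT 0 gx)) (fOf κ Φ t p O (KS.fT 0 fx))).ψ (φL κ Φ t p O.D O.DT O.ori (gOf κ Φ t p O (KS.gT 0 gx)) (fOf κ Φ t p O (KS.fT 0 fx))) t yF = (fcellsA κ Φ t p O.merged (gOf κ Φ t p O (KS.gT 0 gx)) (fOf κ Φ t p O (KS.fT 0 fx))).faceCen x du j) (hpc : pc = relφ (φL κ Φ t p O.D O.DT O.ori (gOf κ Φ t p O (KS.gT 0 gx)) (fOf κ Φ t p O (KS.fT 0 fx))) t yF ((prFA κ Φ t p O.merged (gOf κ Φ t p O (KS.gT 0 gx)) (fOf κ Φ t p O (KS.fT 0 fx))).bOf du.1))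
      (h1 : (prFA κ Φ t p O.merged (gOf κ Φ t p O (KS.gT 0 gx)) (fOf κ Φ t p O (KS.fT 0 fx))).frame (φL κ Φ t p O.D O.DT O.ori (gOf κ Φ t p O (KS.gT 0 gx)) (fOf κ Φ t p O (KS.fT 0 fx))) t du.1 ((prFA κ Φ t p O.merged (gOf κ Φ t p O (KS.gT 0 gx)) (fOf κ Φ t p O (KS.fT 0 fx))).bOf du.1) c' ∈ Finset.Icc (loN (fcellsA κ Φ t p O.merged (gOf κ Φ t p O (KS.gT 0 gx)) (fOf κ Φ t p O (KS.fT 0 fx))) x du j pc ((fun du : MDir => ((prFA κ Φ t p O.merged (gOf κ Φ t p O (KS.gT 0 gx)) (fOf κ Φ t p O (KS.fT 0 fx))).awF₂ (fcellsA κ Φ t p O.merged (gOf κ Φ t p O (KS.gT 0 gx)) (fOf κ Φ t p O (KS.fT 0 fx))) du).toNat) du) - (((KS.RlevA κ Φ t p O.merged 0 + KS.reachA t O.merged 0) : ℕ) : Site 2)) (hiN (fcellsA κ Φ t p O.merged (gOf κ Φ t p O (KS.gT 0 gx)) (fOf κ Φ t p O (KS.fT 0 fx))) x du j pc ((fun du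 : MDir => ((prFA κ Φ t p O.merged (gOf κ Φ t p O (KS.gT 0 gx)) (fOf κ Φ t p O (KS.fT 0 fx))).awF₂ (fcellsA κ Φ t p O.merged (gOf κ Φ t p O (KS.gT 0 gx)) (fOf κ Φ t p O (KS.fT 0 fx))) du).toNat) du) + (((KS.RlevA κ Φ t p O.merged 0 + KS.reachA t O.merged 0) : ℕ) : Site 2)))
      (h2 : c' ∈ graphBall G t ((concRadii2N (fcellsA κ Φ t p O.merged (gOf κ Φ t p O (KS.gT 0 gx)) (fOf κ Φ t p O (KS.fT 0 fx))) (Skelφ.Prm.gap ((SUA ex mx) κ Φ t p O.merged (gOf κ Φ t p O (KS.gT 0 gx)) (fOf κ Φ t p O (KS.fT 0 fx)) q)) (fun _ : ℕ => (0:ℕ)) (Skelφ.Prm.E₀ ((SUA ex mx) κ Φ t p O.merged (gOf κ Φ t p O (KS.gT 0 gx)) (fOf κ Φ t p O (KS.fT 0 fx)) q)) (Skelφ.Prm.Lp ((SUA ex mx) κ Φ t p O.merged (gOf κ Φ t p O (KS.gT 0 gx)) (fOf κ Φ t p O (KS.fT 0 fx)) q)) (offNA κ Φ t p O.merged (gOf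 κ Φ t p O (KS.gT 0 gx)) (fOf κ Φ t p O (KS.fT 0 fx)))).rE a' x du - (Skelφ.Prm.Lp (SUA ex mx κ Φ t p O.merged (gOf κ Φ t p O (KS.gT 0 gx)) (fOf κ Φ t p O (KS.fT 0 fx)) q))))
      (hM : (Skelφ.Prm.Lp ((SUA ex mx) κ Φ t p O.merged (gOf κ Φ t p O (KS.gT 0 gx)) (fOf κ Φ t p O (KS.fT 0 fx)) q)) ≤ (concRadii2N (fcellsA κ Φ t p O.merged (gOf κ Φ t p O (KS.gT 0 gx)) (fOf κ Φ t p O (KS.fT 0 fx))) (Skelφ.Prm.gap ((SUA ex mx) κ Φ t p O.merged (gOf κ Φ t p O (KS.gT 0 gx)) (fOf κ Φ t p O (KS.fT 0 fx)) q)) (fun _ : ℕ => (0:ℕ)) (Skelφ.Prm.E₀ ((SUA ex mx) κ Φ t p O.merged (gOf κ Φ t p O (KS.gT 0 gx)) (fOf κ Φ t p O (KS.fT 0 fx)) q)) (Skelφ.Prm.Lp ((SUA ex mx) κ Φ t p O.merged (gOf κ Φ t p O (KS.gT 0 gx)) (fOf κ Φ t p O (KS.fT 0 fx)) q)) (offNA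 κ Φ t p O.merged (gOf κ Φ t p O (KS.gT 0 gx)) (fOf κ Φ t p O (KS.fT 0 fx)))).rM a' (x + stepVec du)) (hE : (Skelφ.Prm.Lp (SUA ex mx κ Φ t p O.merged (gOf κ Φ t p O (KS.gT 0 gx)) (fOf κ Φ t p O (KS.fT 0 fx)) q)) ≤ (concRadii2N (fcellsA κ Φ t p O.merged (gOf κ Φ t p O (KS.gT 0 gx)) (fOf κ Φ t p O (KS.fT 0 fx))) (Skelφ.Prm.gap ((SUA ex mx) κ Φ t p O.merged (gOf κ Φ t p O (KS.gT 0 gx)) (fOf κ Φ t p O (KS.fT 0 fx)) q)) (fun _ : ℕ => (0:ℕ)) (Skelφ.Prm.E₀ ((SUA ex mx) κ Φ t p O.merged (gOf κ Φ t p O (KS.gT 0 gx)) (fOf κ Φ t p O (KS.fT 0 fx)) q)) (Skelφ.Prm.Lp ((SUA ex mx) κ Φ t p O.merged (gOf κ Φ t p O (KS.gT 0 gx)) (fOf κ Φ t p O (KS.fT 0 fx)) q)) (offNA κ Φ t p O.merged (gOf κ Φ t p O (KS.gT 0 gx)) (fOf κ Φ t p O (KS.fT 0 fx)))).rE a' x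 du),
      0 + 1 + (numsX a' x du j pc c' hI hj yF hyF hpc h1 h2 hM hE).Nr + 1 + (numsX a' x du j pc c' hI hj yF hyF hpc h1 h2 hM hE).N₃ ≤ (NegB.nFA κ.K₀))
    (hnFy : ∀ (a' : ℕ) (x : Site 2) (du : MDir) (j : ℕ) (pc : ℤ) (c' : V) (hI : du.1 = 1) (hj : j < (fcellsA κ Φ t p O.merged (gOf κ Φ t p O (KS.gT 0 gx)) (fOf κ Φ t p O (KS.fT 0 fx))).K) (yF : V)
      (hyF : (prFA κ Φ t p O.merged (gOf κ Φ t p O (KS.gT 0 gx)) (fOf κ Φ t p O (KS.fT 0 fx))).ψ (φL κ Φ t p O.D O.DT O.ori (gOf κ Φ t p O (KS.gT 0 gx)) (fOf κ Φ t p O (KS.fT 0 fx))) t yF = (fcellsA κ Φ t p O.merged (gOf κ Φ t p O (KS.gT 0 gx)) (fOf κ Φ t p O (KS.fT 0 fx))).faceCen x du j) (hpc : pc = relφ (φL κ Φ t p O.D O.DT O.ori (gOf κ Φ t p O (KS.gT 0 gx)) (fOf κ Φ t p O (KS.fT 0 fx))) t yF ((prFA κ Φ t p O.merged (gOf κ Φ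 t p O (KS.gT 0 gx)) (fOf κ Φ t p O (KS.fT 0 fx))).bOf du.1))
      (h1 : (prFA κ Φ t p O.merged (gOf κ Φ t p O (KS.gT 0 gx)) (fOf κ Φ t p O (KS.fT 0 fx))).frame (φL κ Φ t p O.D O.DT O.ori (gOf κ Φ t p O (KS.gT 0 gx)) (fOf κ Φ t p O (KS.fT 0 fx))) t du.1 ((prFA κ Φ t p O.merged (gOf κ Φ t p O (KS.gT 0 gx)) (fOf κ Φ t p O (KS.fT 0 fx))).bOf du.1) c' ∈ Finset.Icc (loN (fcellsA κ Φ t p O.merged (gOf κ Φ t p O (KS.gT 0 gx)) (fOf κ Φ t p O (KS.fT 0 fx))) x du j pc ((fun du : MDir => ((prFA κ Φ t p O.merged (gOf κ Φ t p O (KS.gT 0 gx)) (fOf κ Φ t p O (KS.fT 0 fx))).awF₂ (fcellsA κ Φ t p O.merged (gOf κ Φ t p O (KS.gT 0 gx)) (fOf κ Φ t p O (KS.fT 0 fx))) du).toNat) du) - (((KS.RlevA κ Φ t p O.merged 0 + KS.reachA t O.merged 0) : ℕ) : Site 2)) (hiN (fcellsA κ Φ t p O.merged (gOf κ Φ t p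 O (KS.gT 0 gx)) (fOf κ Φ t p O (KS.fT 0 fx))) x du j pc ((fun du : MDir => ((prFA κ Φ t p O.merged (gOf κ Φ t p O (KS.gT 0 gx)) (fOf κ Φ t p O (KS.fT 0 fx))).awF₂ (fcellsA κ Φ t p O.merged (gOf κ Φ t p O (KS.gT 0 gx)) (fOf κ Φ t p O (KS.fT 0 fx))) du).toNat) du) + (((KS.RlevA κ Φ t p O.merged 0 + KS.reachA t O.merged 0) : ℕ) : Site 2)))
      (h2 : c' ∈ graphBall G t ((concRadii2N (fcellsA κ Φ t p O.merged (gOf κ Φ t p O (KS.gT 0 gx)) (fOf κ Φ t p O (KS.fT 0 fx))) (Skelφ.Prm.gap ((SUA ex mx) κ Φ t p O.merged (gOf κ Φ t p O (KS.gT 0 gx)) (fOf κ Φ t p O (KS.fT 0 fx)) q)) (fun _ : ℕ => (0:ℕ)) (Skelφ.Prm.E₀ ((SUA ex mx) κ Φ t p O.merged (gOf κ Φ t p O (KS.gT 0 gx)) (fOf κ Φ t p O (KS.fT 0 fx)) q)) (Skelφ.Prm.Lp ((SUA ex mx) κ Φ t p O.merged (gOf κ Φ t p O (KS.gT 0 gx))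 (fOf κ Φ t p O (KS.fT 0 fx)) q)) (offNA κ Φ t p O.merged (gOf κ Φ t p O (KS.gT 0 gx)) (fOf κ Φ t p O (KS.fT 0 fx)))).rE a' x du - (Skelφ.Prm.Lp (SUA ex mx κ Φ t p O.merged (gOf κ Φ t p O (KS.gT 0 gx)) (fOf κ Φ t p O (KS.fT 0 fx)) q))))
      (hM : (Skelφ.Prm.Lp ((SUA ex mx) κ Φ t p O.merged (gOf κ Φ t p O (KS.gT 0 gx)) (fOf κ Φ t p O (KS.fT 0 fx)) q)) ≤ (concRadii2N (fcellsA κ Φ t p O.merged (gOf κ Φ t p O (KS.gT 0 gx)) (fOf κ Φ t p O (KS.fT 0 fx))) (Skelφ.Prm.gap ((SUA ex mx) κ Φ t p O.merged (gOf κ Φ t p O (KS.gT 0 gx)) (fOf κ Φ t p O (KS.fT 0 fx)) q)) (fun _ : ℕ => (0:ℕ)) (Skelφ.Prm.E₀ ((SUA ex mx) κ Φ t p O.merged (gOf κ Φ t p O (KS.gT 0 gx)) (fOf κ Φ t p O (KS.fT 0 fx)) q)) (Skelφ.Prm.Lp ((SUA ex mx) κ Φ t p O.merged (gOf κ Φ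 t p O (KS.gT 0 gx)) (fOf κ Φ t p O (KS.fT 0 fx)) q)) (offNA κ Φ t p O.merged (gOf κ Φ t p O (KS.gT 0 gx)) (fOf κ Φ t p O (KS.fT 0 fx)))).rM a' (x + stepVec du)) (hE : (Skelφ.Prm.Lp (SUA ex mx κ Φ t p O.merged (gOf κ Φ t p O (KS.gT 0 gx)) (fOf κ Φ t p O (KS.fT 0 fx)) q)) ≤ (concRadii2N (fcellsA κ Φ t p O.merged (gOf κ Φ t p O (KS.gT 0 gx)) (fOf κ Φ t p O (KS.fT 0 fx))) (Skelφ.Prm.gap ((SUA ex mx) κ Φ t p O.merged (gOf κ Φ t p O (KS.gT 0 gx)) (fOf κ Φ t p O (KS.fT 0 fx)) q)) (fun _ : ℕ => (0:ℕ)) (Skelφ.Prm.E₀ ((SUA ex mx) κ Φ t p O.merged (gOf κ Φ t p O (KS.gT 0 gx)) (fOf κ Φ t p O (KS.fT 0 fx)) q)) (Skelφ.Prm.Lp ((SUA ex mx) κ Φ t p O.merged (gOf κ Φ t p O (KS.gT 0 gx)) (fOf κ Φ t p O (KS.fT 0 fx)) q)) (offNA κ Φ t p O.merged (gOf κ Φ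 t p O (KS.gT 0 gx)) (fOf κ Φ t p O (KS.fT 0 fx)))).rE a' x du),
      0 + 1 + (numsY a' x du j pc c' hI hj yF hyF hpc h1 h2 hM hE).Nr + 1 + (numsY a' x du j pc c' hI hj yF hyF hpc h1 h2 hM hE).N₃ ≤ (NegB.nFA κ.K₀)) :
    Skelφ.FaceOblRM G ((choiceAtOTA κ Φ t p (KS.gT 0 gx) (KS.fT 0 fx) (SUA ex mx) hC (KS.PR 0 Px)).scheme O q)
      ((choiceAtOTA κ Φ t p (KS.gT 0 gx) (KS.fT 0 fx) (SUA ex mx) hC (KS.PR 0 Px)).FD O q) Φ.Δ κ.δ₂ := by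
  -- facts at `AtQO`
  have hAtS := atQOS_of_atQOTA hAt
  have hAtB := atQOB_of_atQOTA hAt
  have hNL : EqNumL κ Φ t p O.merged (gOf κ Φ t p O (KS.gT 0 gx)) (fOf κ Φ t p O (KS.fT 0 fx)) := eqNumL_of_atQOTA hAt
  obtain ⟨hnL1, hℓL1⟩ := one_le_of_eqNumL κ Φ t p O.merged (gOf κ Φ t p O (KS.gT 0 gx)) (fOf κ Φ t p O (KS.fT 0 fx)) hNL
  obtain ⟨hF, hq1, hq2, hCq⟩ := factsO_of_atQOTA hAt
  obtain ⟨-, -, hkM₀, hReq, hΛeq⟩ := hF.seed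
  have hκ10 : (hL κ Φ t p O.merged (gOf κ Φ t p O (KS.gT 0 gx)) (fOf κ Φ t p O (KS.fT 0 fx))).natAbs ≤ 10 * nL κ Φ t p O.merged (gOf κ Φ t p O (KS.gT 0 gx)) (fOf κ Φ t p O (KS.fT 0 fx)) := (clauseL_of_atQOTA hAt).2
  have hRA := KS.RA'_eq κ Φ t p O.merged 0
  have hZ : ∀ c, (↑(O.merged.Λ c (Mu O.merged)) : Set V) ⊆ Skelφ.cyl (φL κ Φ t p O.D O.DT O.ori (gOf κ Φ t p O (KS.gT 0 gx)) (fOf κ Φ t p O (KS.fT 0 fx))) c (Mu O.merged) := fun c => by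
    unfold NegB.φL; rw [Skelφ.cyl_oriφ, hΛeq]; exact Skelφ.fatSeq_subset_cyl Φ.frame hC c _
  -- the F pair: clause, numbers, lengths
  have hEF := clauseB_of_factsO Φ t O.D O.DT O.ori (KS.mbF κ Φ t p O.merged cF 0) (KS.bF κ Φ t p O.merged cF 0) hAtS.1.shared.2.2.1 hAtS.1.clauses
  have hκb : (KS.hBF κ Φ t p O.merged cF 0).natAbs ≤ 10 * KS.nBF κ Φ t p O.merged cF 0 := hEF.2
  obtain ⟨-, -, -, hlayb0⟩ := eqNumB_of_eqGeom t O.merged (KS.mbF κ Φ t p O.merged cF 0) (KS.bF κ Φ t p O.merged cF 0) _ hEF.1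
  have hlayb : ((KS.MBF κ Φ t p O.merged cF 0 : ℤ) + 1) * ((KS.nBF κ Φ t p O.merged cF 0 : ℤ) + |KS.hBF κ Φ t p O.merged cF 0|) ≤
      (KS.nBF κ Φ t p O.merged cF 0 : ℤ) * ((KS.ℓBF κ Φ t p O.merged cF 0 : ℤ) + 1) := hlayb0
  have hℓ27 : 27 ≤ KS.ℓBF κ Φ t p O.merged cF 0 := by have h := KS.ℓBF_ge κ Φ t p O.merged cF 0 _ hEF.1; omega
  have hℓ3 : 3 ≤ KS.ℓBF κ Φ t p O.merged cF 0 := by omega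
  have hMBf := KS.MBF_floors κ Φ t p O.merged cF 0
  have hRF := KS.RF2F κ Φ t p O.merged cF 0
  have hnb : 1 ≤ KS.nBF κ Φ t p O.merged cF 0 := by have := hRF.2.1; omega
  have hMzb : Mu O.merged < KS.nBF κ Φ t p O.merged cF 0 := lt_of_le_of_lt hMBf.2.2 hRF.2.1
  have hclrb : (Mu O.merged + 4) * (KS.nBF κ Φ t p O.merged cF 0 + (KS.hBF κ Φ t p O.merged cF 0).natAbs) ≤
      KS.nBF κ Φ t p O.merged cF 0 * (KS.ℓBF κ Φ t p O.merged cF 0 + 1) :=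
    bridge_clr_aux _ _ _ _ _ (by have := hMBf.2.1; omega) hlayb
  -- the F pair's pieces at every centre, served for `P_q` (both families, all signs), at accuracy `δkit²`
  have hPbF := hPx
  have hδI2 : Neg.δI κ Φ ≤ Neg.δkit κ Φ ^ 2 := Neg.δI_le_sq_of_le κ Φ le_rfl
  have hservedB : ∀ (c : V) (σ' τ' : ℤ), (σ' = 1 ∨ σ' = -1) → (τ' = 1 ∨ τ' = -1) →
      1 - Neg.δkit κ Φ ^ 2 < (bondPercolation G q).real (linkIn
        (Skelφ.pgramPrism G (oriφ Φ.φ (O.ori t (KS.MBF κ Φ t p O.merged cF 0) (KS.nBF κ Φ t p O.merged cF 0))) c (KS.nBF κ Φ t p O.merged cF 0) (KS.hBF κ Φ t p O.merged cF 0)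
          (3 * KS.ℓBF κ Φ t p O.merged cF 0) (O.merged.R (O.merged.scale t (KS.MBF κ Φ t p O.merged cF 0) (KS.nBF κ Φ t p O.merged cF 0)))) (O.merged.Λ c O.merged.k)
        (pgSideHalfW G (oriφ Φ.φ (O.ori t (KS.MBF κ Φ t p O.merged cF 0) (KS.nBF κ Φ t p O.merged cF 0))) c (KS.nBF κ Φ t p O.merged cF 0) (KS.hBF κ Φ t p O.merged cF 0)
          (KS.ℓBF κ Φ t p O.merged cF 0) (O.merged.R (O.merged.scale t (KS.MBF κ Φ t p O.merged cF 0) (KS.nBF κ Φ t p O.merged cF 0))) σ' τ')) ∧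
      1 - Neg.δkit κ Φ ^ 2 < (bondPercolation G q).real (linkIn
        (Skelφ.pgramPrism G (oriφ Φ.φ (O.ori t (KS.MBF κ Φ t p O.merged cF 0) (KS.nBF κ Φ t p O.merged cF 0))) c (KS.nBF κ Φ t p O.merged cF 0) (KS.hBF κ Φ t p O.merged cF 0)
          (3 * KS.ℓBF κ Φ t p O.merged cF 0) (O.merged.R (O.merged.scale t (KS.MBF κ Φ t p O.merged cF 0) (KS.nBF κ Φ t p O.merged cF 0)))) (O.merged.Λ c O.merged.k)
        (pgTopPieceW G (oriφ Φ.φ (O.ori t (KS.MBF κ Φ t p O.merged cF 0) (KS.nBF κ Φ t p O.merged cF 0))) c (KS.nBF κ Φ t p O.merged cF 0) (KS.hBF κ Φ t p O.merged cF 0)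
          (KS.ℓBF κ Φ t p O.merged cF 0) (O.merged.R (O.merged.scale t (KS.MBF κ Φ t p O.merged cF 0) (KS.nBF κ Φ t p O.merged cF 0))) σ' τ' (KS.vBF κ Φ t p O.merged cF 0))) := by
    intro c σ' τ' hσ' hτ'
    have ha := inputsExtraAt_of_atQOB hAtB h1 c hPbF 0 (Skelφ.sgnU σ') (Skelφ.sgnU τ')
    have hb := inputsExtraAt_of_atQOB hAtB h1 c hPbF 1 (Skelφ.sgnU σ') (Skelφ.sgnU τ')
    rw [Skelφ.StepI.eventNAt_some] at ha hb
    unfold Skelφ.StepI.regionNAt Skelφ.StepI.pieceNAt at ha hb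
    rw [if_pos rfl, Skelφ.val_sgnU hσ', Skelφ.val_sgnU hτ'] at ha
    rw [if_neg (by decide), Skelφ.val_sgnU hσ', Skelφ.val_sgnU hτ'] at hb
    exact ⟨lt_of_le_of_lt (by linarith [hδI2]) ha, lt_of_le_of_lt (by linarith [hδI2]) hb⟩
  -- the long numbers and the F-Λ block
  have HNL := one_le_nL_of_atQOS hAtS
  have HVL := abs_vL_le_of_atQOS hAtS
  have HLAY := layer_of_atQOS hAtS
  have hKC : 11 * Mu O.merged ≤ KS.reachA t O.merged 0 := by unfold KS.reachA KS.KCmax; omega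
  have hMe : ((Mu O.merged : ℕ) : ℤ) ≤ (KS.eF κ Φ t p O.merged cF 0 : ℤ) := by
    have h : Mu O.merged ≤ KS.eF κ Φ t p O.merged cF 0 := by unfold KS.eF; have := hRA.1; omega
    exact_mod_cast h
  have hΛZ2 := faceLam_zone κ Φ t p O.merged cF 0 (gOf κ Φ t p O (KS.gT 0 gx)) (fOf κ Φ t p O (KS.fT 0 fx)) hNL hMe
  -- the radius facts for the bridge reach: `YbF ≤ L′`
  have hfl := floors_exA κ Φ t p O.merged (gOf κ Φ t p O (KS.gT 0 gx)) (fOf κ Φ t p O (KS.fT 0 fx))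
  have hLp : (ex κ Φ t p O.merged (gOf κ Φ t p O (KS.gT 0 gx)) (fOf κ Φ t p O (KS.fT 0 fx))) ≤ (Skelφ.Prm.Lp (SUA ex mx κ Φ t p O.merged (gOf κ Φ t p O (KS.gT 0 gx)) (fOf κ Φ t p O (KS.fT 0 fx)) q)) := (ex_le_Lp_UA κ Φ t p O.merged (gOf κ Φ t p O (KS.gT 0 gx)) (fOf κ Φ t p O (KS.fT 0 fx)) ex mx q).1
  have hMLnL := (ML_lt_nL κ Φ t p O.merged (gOf κ Φ t p O (KS.gT 0 gx)) (fOf κ Φ t p O (KS.fT 0 fx))).1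
  have hSFn : KS.SF κ Φ t p O.merged cF 0 ≤ nL κ Φ t p O.merged (gOf κ Φ t p O (KS.gT 0 gx)) (fOf κ Φ t p O (KS.fT 0 fx)) := by have h := hSF16; omega
  have hRAn : KS.RA' κ Φ t p O.merged 0 ≤ nL κ Φ t p O.merged (gOf κ Φ t p O (KS.gT 0 gx)) (fOf κ Φ t p O (KS.fT 0 fx)) := by
    have h : KS.RA' κ Φ t p O.merged 0 + 2 ≤ nL κ Φ t p O.merged (gOf κ Φ t p O (KS.gT 0 gx)) (fOf κ Φ t p O (KS.fT 0 fx)) := (KS.nL_floorsT κ Φ t p O.merged 0 fx (gOf κ Φ t p O (KS.gT 0 gx))).2.2.2.2.1; omega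
  have hYb := KS.YbF_le_exA κ Φ t p O.merged cF 0 (gOf κ Φ t p O (KS.gT 0 gx)) (fOf κ Φ t p O (KS.fT 0 fx)) hκ10 hSFn hRAn hnL1
  have hYbLp : KS.YbF κ Φ t p O.merged cF 0 (gOf κ Φ t p O (KS.gT 0 gx)) (fOf κ Φ t p O (KS.fT 0 fx)) ≤ (Skelφ.Prm.Lp (SUA ex mx κ Φ t p O.merged (gOf κ Φ t p O (KS.gT 0 gx)) (fOf κ Φ t p O (KS.fT 0 fx)) q)) := by have := hex.1; omega
  have hBD := fun (c : V) {σ' : ℤ} (hσ' : σ' = 1 ∨ σ' = -1) =>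
    Skelφ.bridgeData_trSide c hσ' (nL κ Φ t p O.merged (gOf κ Φ t p O (KS.gT 0 gx)) (fOf κ Φ t p O (KS.fT 0 fx))) (hL κ Φ t p O.merged (gOf κ Φ t p O (KS.gT 0 gx)) (fOf κ Φ t p O (KS.fT 0 fx))) (ℓL κ Φ t p O.merged (gOf κ Φ t p O (KS.gT 0 gx)) (fOf κ Φ t p O (KS.fT 0 fx))) (KS.RA' κ Φ t p O.merged 0) hnb (KS.hBF κ Φ t p O.merged cF 0) (KS.ℓBF κ Φ t p O.merged cF 0) (O.merged.R (O.merged.scale t (KS.MBF κ Φ t p O.merged cF 0) (KS.nBF κ Φ t p O.merged cF 0))) (KS.vBF κ Φ t p O.merged cF 0) hZ hservedB hMzb htr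
  exact faceOblRM_negBTC₂ (Λ₀ := (KS.ΛF₀ κ Φ t p O.merged cF 0 (gOf κ Φ t p O (KS.gT 0 gx)) (fOf κ Φ t p O (KS.fT 0 fx)))) (Λ₁ := (KS.ΛF₁ κ Φ t p O.merged cF 0 (gOf κ Φ t p O (KS.gT 0 gx)) (fOf κ Φ t p O (KS.fT 0 fx)))) (kA := (fun i : Fin 2 => if i = 0 then KS.kF₀A κ Φ t p O.merged cF 0 (gOf κ Φ t p O (KS.gT 0 gx)) (fOf κ Φ t p O (KS.fT 0 fx)) else KS.kF₁A κ Φ t p O.merged cF 0 (gOf κ Φ t p O (KS.gT 0 gx)) (fOf κ Φ t p O (KS.fT 0 fx)))) cF gx fx Px ex mx hAt hmx hex h1 hp0 hp1 (one_le_nL_of_atQOS (atQOS_of_atQOTA hAt)) (abs_vL_le_of_atQOS (atQOS_of_atQOTA hAt)) (fun σ' : ℤ => KS.BFd κ Φ t p O.merged cF 0 (gOf κ Φ t p O (KS.gT 0 gx)) (fOf κ Φ t p O (KS.fT 0 fx)) σ') (fun σ' hσ' => (KS.BF_ok κ Φ t p O.merged cF 0 (gOf κ Φ t p O (KS.gT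 0 gx)) (fOf κ Φ t p O (KS.fT 0 fx)) hσ' hℓ3).2.1) σhF hσhF qB qB₃ qB' qB₃' (layer_of_atQOS (atQOS_of_atQOTA hAt)) (fun σ' _ => (KS.BF_R'_ge κ Φ t p O.merged cF 0 (gOf κ Φ t p O (KS.gT 0 gx)) (fOf κ Φ t p O (KS.fT 0 fx)) σ').2.1) (fun σ' _ => (KS.hB0_F κ Φ t p O.merged cF 0 (gOf κ Φ t p O (KS.gT 0 gx)) (fOf κ Φ t p O (KS.fT 0 fx)) σ').2.1) (fun σ' hσ' => KS.hΛR_F κ Φ t p O.merged cF 0 (gOf κ Φ t p O (KS.gT 0 gx)) (fOf κ Φ t p O (KS.fT 0 fx)) hNL hσ') (KS.hΛQ_F κ Φ t p O.merged cF 0 (gOf κ Φ t p O (KS.gT 0 gx)) (fOf κ Φ t p O (KS.fT 0 fx))).1 (KS.hΛQ_F κ Φ t p O.merged cF 0 (gOf κ Φ t p O (KS.gT 0 gx)) (fOf κ Φ t p O (KS.fT 0 fx))).2 hΛZ2 (KS.hkF0_RA κ Φ t p O.merged cF 0 (gOf κ Φ t p O (KS.gT 0 gx)) (fOf κ Φ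 t p O (KS.fT 0 fx)) hNL) (KS.hkF1_RA κ Φ t p O.merged cF 0 (gOf κ Φ t p O (KS.gT 0 gx)) (fOf κ Φ t p O (KS.fT 0 fx)) hNL) (fun σ' hσ' => le_trans (KS.core1LoF_l1 κ Φ t p O.merged cF 0 (gOf κ Φ t p O (KS.gT 0 gx)) (fOf κ Φ t p O (KS.fT 0 fx)) hσ' hℓ27).2.1 hYbLp) (fun σ' _ => (KS.hclr₁_BF κ Φ t p O.merged cF 0 gx (fOf κ Φ t p O (KS.fT 0 fx)) hSF16 σ').2.1) hCF (fun σ' hσ' j hj _ => (rootKit_levels Φ t O.merged 0 _ _ ((KS.BF_ok κ Φ t p O.merged cF 0 (gOf κ Φ t p O (KS.gT 0 gx)) (fOf κ Φ t p O (KS.fT 0 fx)) hσ' hℓ3).2.1).h0 hj).1) (fun σ' hσ' j hj _ => (rootKit_levels Φ t O.merged 0 _ _ ((KS.BF_ok κ Φ t p O.merged cF 0 (gOf κ Φ t p O (KS.gT 0 gx)) (fOf κ Φ t p O (KS.fT 0 fx)) hσ' hℓ3).2.1).h0 hj).2.1) (fun σ' hσ' j hj _ => (rootKit_levels Φ t O.merged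 0 _ _ ((KS.BF_ok κ Φ t p O.merged cF 0 (gOf κ Φ t p O (KS.gT 0 gx)) (fOf κ Φ t p O (KS.fT 0 fx)) hσ' hℓ3).2.1).h0 hj).2.2) (fun σ' _ => le_trans (rootKit_reach κ Φ t p O.merged 0 _ _) (by rw [← hRA.2.1]; exact (KS.BF_R'_ge κ Φ t p O.merged cF 0 (gOf κ Φ t p O (KS.gT 0 gx)) (fOf κ Φ t p O (KS.fT 0 fx)) σ').2.1)) (fun (_ : ℤ) (c' : V) => pgramPrismFin G (trφ (φL κ Φ t p O.D O.DT O.ori (gOf κ Φ t p O (KS.gT 0 gx)) (fOf κ Φ t p O (KS.fT 0 fx)))) c' (KS.nBF κ Φ t p O.merged cF 0) (KS.hBF κ Φ t p O.merged cF 0) (3 * (KS.ℓBF κ Φ t p O.merged cF 0)) (O.merged.R (O.merged.scale t (KS.MBF κ Φ t p O.merged cF 0) (KS.nBF κ Φ t p O.merged cF 0)))) (fun (σ' : ℤ) (c' : V) => pgSideHalfW G (trφ (φL κ Φ t p O.D O.DT O.ori (gOf κ Φ t p O (KS.gT 0 gx)) (fOf κ Φ t p O (KS.fT 0 fx)))) c'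 (KS.nBF κ Φ t p O.merged cF 0) (KS.hBF κ Φ t p O.merged cF 0) (KS.ℓBF κ Φ t p O.merged cF 0) (O.merged.R (O.merged.scale t (KS.MBF κ Φ t p O.merged cF 0) (KS.nBF κ Φ t p O.merged cF 0))) (σ' * Skelφ.sgnz (KS.hBF κ Φ t p O.merged cF 0)) σ') (fun σ' hσ' c c' w hw => (hBD c hσ').1 c' w hw) (fun σ' hσ' c c' w hw => (hBD c hσ').2.1 c' w hw) (fun σ' hσ' c' => (hBD c' hσ').2.2.1 c') (fun σ' hσ' c' => (hBD c' hσ').2.2.2 c') numsX numsY hnFx hnFy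

set_option maxHeartbeats 1600000 in
/-- **Layer (b), part B3 of the (F) wrapper, case `o_F ≠ o_L`, bridge = a top piece of `trφ φL` (the flat side condition `2|h_F| ≤ ℓ_F` is read only by the floors, not here)** (see the module docstring). [cite: KozmaNitzan2024, §4 Lemma 10 (pp. 17–21), Lemma 12 (pp. 23–25)] -/
theorem faceOblRM_negBTC₃t (cF : ℕ) (gx fx : Neg.FSlot) (Px : PSlot) (ex mx : GSlot)
    (hAt : (choiceAtOTA κ Φ t p (KS.gT 0 gx) (KS.fT 0 fx) (SUA ex mx) hC (KS.PR 0 Px)).AtQO O q)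
    (hmx : (prFA κ Φ t p O.merged (gOf κ Φ t p O (KS.gT 0 gx)) (fOf κ Φ t p O (KS.fT 0 fx))).mF (fcellsA κ Φ t p O.merged (gOf κ Φ t p O (KS.gT 0 gx)) (fOf κ Φ t p O (KS.fT 0 fx))) ≤ ((mx κ Φ t p O.merged (gOf κ Φ t p O (KS.gT 0 gx)) (fOf κ Φ t p O (KS.fT 0 fx)) : ℕ) : ℤ))
    (hex : exA κ Φ t p O.merged (gOf κ Φ t p O (KS.gT 0 gx)) (fOf κ Φ t p O (KS.fT 0 fx)) ≤ ex κ Φ t p O.merged (gOf κ Φ t p O (KS.gT 0 gx)) (fOf κ Φ t p O (KS.fT 0 fx)) ∧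
      KS.r₀A Φ t O.merged 0 (O.merged.R (O.merged.scale t (KS.MBF κ Φ t p O.merged cF 0) (KS.nBF κ Φ t p O.merged cF 0))) + 1 ≤ ex κ Φ t p O.merged (gOf κ Φ t p O (KS.gT 0 gx)) (fOf κ Φ t p O (KS.fT 0 fx)))
    (hSF16 : 16 * KS.SF κ Φ t p O.merged cF 0 ≤ ML κ Φ t p O.merged (gOf κ Φ t p O (KS.gT 0 gx)))
    (hPx : (KS.MBF κ Φ t p O.merged cF 0, KS.nBF κ Φ t p O.merged cF 0) ∈ (KS.PR 0 Px κ Φ t p O.merged).1)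
    (htr : oriφ Φ.φ (O.ori t (KS.MBF κ Φ t p O.merged cF 0) (KS.nBF κ Φ t p O.merged cF 0)) = trφ (φL κ Φ t p O.D O.DT O.ori (gOf κ Φ t p O (KS.gT 0 gx)) (fOf κ Φ t p O (KS.fT 0 fx))))(h1 : Φ.types = {t}) (hp0 : 0 < (p : ℝ)) (hp1 : (p : ℝ) < 1)
      (σhF : MDir → ℤ) (hσhF : ∀ du : MDir, σhF du = 1 ∨ σhF du = -1)
     (qB qB₃ qB' qB₃' : ℕ)
       (hCF : ChainFactL NegB.LfA G Φ.Δ κ)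
    (numsX : ∀ (a' : ℕ) (x : Site 2) (du : MDir) (j : ℕ) (pc : ℤ) (c' : V), du.1 = 0 → j < (fcellsA κ Φ t p O.merged (gOf κ Φ t p O (KS.gT 0 gx)) (fOf κ Φ t p O (KS.fT 0 fx))).K → ∀ yF : V,
      (prFA κ Φ t p O.merged (gOf κ Φ t p O (KS.gT 0 gx)) (fOf κ Φ t p O (KS.fT 0 fx))).ψ (φL κ Φ t p O.D O.DT O.ori (gOf κ Φ t p O (KS.gT 0 gx)) (fOf κ Φ t p O (KS.fT 0 fx))) t yF = (fcellsA κ Φ t p O.merged (gOf κ Φ t p O (KS.gT 0 gx)) (fOf κ Φ t p O (KS.fT 0 fx))).faceCen x du j → pc = relφ (φL κ Φ t p O.D O.DT O.ori (gOf κ Φ t p O (KS.gT 0 gx)) (fOf κ Φ t p O (KS.fT 0 fx))) t yF ((prFA κ Φ t p O.merged (gOf κ Φ t p O (KS.gT 0 gx)) (fOf κ Φ t p O (KS.fT 0 fx))).bOf du.1) →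
      (prFA κ Φ t p O.merged (gOf κ Φ t p O (KS.gT 0 gx)) (fOf κ Φ t p O (KS.fT 0 fx))).frame (φL κ Φ t p O.D O.DT O.ori (gOf κ Φ t p O (KS.gT 0 gx)) (fOf κ Φ t p O (KS.fT 0 fx))) t du.1 ((prFA κ Φ t p O.merged (gOf κ Φ t p O (KS.gT 0 gx)) (fOf κ Φ t p O (KS.fT 0 fx))).bOf du.1) c' ∈ Finset.Icc (loN (fcellsA κ Φ t p O.merged (gOf κ Φ t p O (KS.gT 0 gx)) (fOf κ Φ t p O (KS.fT 0 fx))) x du j pc ((fun du : MDir => ((prFA κ Φ t p O.merged (gOf κ Φ t p O (KS.gT 0 gx)) (fOf κ Φ t p O (KS.fT 0 fx))).awF₂ (fcellsA κ Φ t p O.merged (gOf κ Φ t p O (KS.gT 0 gx)) (fOf κ Φ t p O (KS.fT 0 fx))) du).toNat) du) - (((KS.RlevA κ Φ t p O.merged 0 + KS.reachA t O.merged 0) : ℕ) : Site 2)) (hiN (fcellsA κ Φ t p O.merged (gOf κ Φ t p O (KS.gT 0 gx)) (fOf κ Φ t p O (KS.fT 0 fx))) x du j pc ((fun du : MDir =>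 ((prFA κ Φ t p O.merged (gOf κ Φ t p O (KS.gT 0 gx)) (fOf κ Φ t p O (KS.fT 0 fx))).awF₂ (fcellsA κ Φ t p O.merged (gOf κ Φ t p O (KS.gT 0 gx)) (fOf κ Φ t p O (KS.fT 0 fx))) du).toNat) du) + (((KS.RlevA κ Φ t p O.merged 0 + KS.reachA t O.merged 0) : ℕ) : Site 2)) →
      c' ∈ graphBall G t ((concRadii2N (fcellsA κ Φ t p O.merged (gOf κ Φ t p O (KS.gT 0 gx)) (fOf κ Φ t p O (KS.fT 0 fx))) (Skelφ.Prm.gap ((SUA ex mx) κ Φ t p O.merged (gOf κ Φ t p O (KS.gT 0 gx)) (fOf κ Φ t p O (KS.fT 0 fx)) q)) (fun _ : ℕ => (0:ℕ)) (Skelφ.Prm.E₀ ((SUA ex mx) κ Φ t p O.merged (gOf κ Φ t p O (KS.gT 0 gx)) (fOf κ Φ t p O (KS.fT 0 fx)) q)) (Skelφ.Prm.Lp ((SUA ex mx) κ Φ t p O.merged (gOf κ Φ t p O (KS.gT 0 gx)) (fOf κ Φ t p O (KS.fT 0 fx)) q)) (offNA κ Φ t p O.merged (gOf κ Φ t p O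 (KS.gT 0 gx)) (fOf κ Φ t p O (KS.fT 0 fx)))).rE a' x du - (Skelφ.Prm.Lp (SUA ex mx κ Φ t p O.merged (gOf κ Φ t p O (KS.gT 0 gx)) (fOf κ Φ t p O (KS.fT 0 fx)) q))) →
      (Skelφ.Prm.Lp ((SUA ex mx) κ Φ t p O.merged (gOf κ Φ t p O (KS.gT 0 gx)) (fOf κ Φ t p O (KS.fT 0 fx)) q)) ≤ (concRadii2N (fcellsA κ Φ t p O.merged (gOf κ Φ t p O (KS.gT 0 gx)) (fOf κ Φ t p O (KS.fT 0 fx))) (Skelφ.Prm.gap ((SUA ex mx) κ Φ t p O.merged (gOf κ Φ t p O (KS.gT 0 gx)) (fOf κ Φ t p O (KS.fT 0 fx)) q)) (fun _ : ℕ => (0:ℕ)) (Skelφ.Prm.E₀ ((SUA ex mx) κ Φ t p O.merged (gOf κ Φ t p O (KS.gT 0 gx)) (fOf κ Φ t p O (KS.fT 0 fx)) q)) (Skelφ.Prm.Lp ((SUA ex mx) κ Φ t p O.merged (gOf κ Φ t p O (KS.gT 0 gx)) (fOf κ Φ t p O (KS.fT 0 fx)) q)) (offNA κ Φ t p O.merged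 (gOf κ Φ t p O (KS.gT 0 gx)) (fOf κ Φ t p O (KS.fT 0 fx)))).rM a' (x + stepVec du) → (Skelφ.Prm.Lp (SUA ex mx κ Φ t p O.merged (gOf κ Φ t p O (KS.gT 0 gx)) (fOf κ Φ t p O (KS.fT 0 fx)) q)) ≤ (concRadii2N (fcellsA κ Φ t p O.merged (gOf κ Φ t p O (KS.gT 0 gx)) (fOf κ Φ t p O (KS.fT 0 fx))) (Skelφ.Prm.gap ((SUA ex mx) κ Φ t p O.merged (gOf κ Φ t p O (KS.gT 0 gx)) (fOf κ Φ t p O (KS.fT 0 fx)) q)) (fun _ : ℕ => (0:ℕ)) (Skelφ.Prm.E₀ ((SUA ex mx) κ Φ t p O.merged (gOf κ Φ t p O (KS.gT 0 gx)) (fOf κ Φ t p O (KS.fT 0 fx)) q)) (Skelφ.Prm.Lp ((SUA ex mx) κ Φ t p O.merged (gOf κ Φ t p O (KS.gT 0 gx)) (fOf κ Φ t p O (KS.fT 0 fx)) q)) (offNA κ Φ t p O.merged (gOf κ Φ t p O (KS.gT 0 gx)) (fOf κ Φ t p O (KS.fT 0 fx)))).rE a' x du →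
      FaceRunNumsX4 G (φL κ Φ t p O.D O.DT O.ori (gOf κ Φ t p O (KS.gT 0 gx)) (fOf κ Φ t p O (KS.fT 0 fx))) ((prFA κ Φ t p O.merged (gOf κ Φ t p O (KS.gT 0 gx)) (fOf κ Φ t p O (KS.fT 0 fx))).ψ (φL κ Φ t p O.D O.DT O.ori (gOf κ Φ t p O (KS.gT 0 gx)) (fOf κ Φ t p O (KS.fT 0 fx))) t) c' (prFA κ Φ t p O.merged (gOf κ Φ t p O (KS.gT 0 gx)) (fOf κ Φ t p O (KS.fT 0 fx))).A (nL κ Φ t p O.merged (gOf κ Φ t p O (KS.gT 0 gx)) (fOf κ Φ t p O (KS.fT 0 fx))) (prFA κ Φ t p O.merged (gOf κ Φ t p O (KS.gT 0 gx)) (fOf κ Φ t p O (KS.fT 0 fx))).h (prFA κ Φ t p O.merged (gOf κ Φ t p O (KS.gT 0 gx)) (fOf κ Φ t p O (KS.fT 0 fx))).vα (prFA κ Φ t p O.merged (gOf κ Φ t p O (KS.gT 0 gx)) (fOf κ Φ t p O (KS.fT 0 fx))).vβ (prFA κ Φ t p O.merged (gOf κ Φ t p O (KS.gT 0 gx)) (fOf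 κ Φ t p O (KS.fT 0 fx))).c₀ (prFA κ Φ t p O.merged (gOf κ Φ t p O (KS.gT 0 gx)) (fOf κ Φ t p O (KS.fT 0 fx))).c₁ (prFA κ Φ t p O.merged (gOf κ Φ t p O (KS.gT 0 gx)) (fOf κ Φ t p O (KS.fT 0 fx))).D du (sgOf du) ((fun σ' : ℤ => KS.BFt κ Φ t p O.merged cF 0 (gOf κ Φ t p O (KS.gT 0 gx)) (fOf κ Φ t p O (KS.fT 0 fx)) σ') (sgOf du)) (ℓL κ Φ t p O.merged (gOf κ Φ t p O (KS.gT 0 gx)) (fOf κ Φ t p O (KS.fT 0 fx))) (KS.RA' κ Φ t p O.merged 0) qB (KS.RA' κ Φ t p O.merged 0) qB₃ (prFA κ Φ t p O.merged (gOf κ Φ t p O (KS.gT 0 gx)) (fOf κ Φ t p O (KS.fT 0 fx))).vα (one_le_nL_of_atQOS (atQOS_of_atQOTA hAt)) (abs_vL_le_of_atQOS (atQOS_of_atQOTA hAt)) (layer_of_atQOS (atQOS_of_atQOTA hAt)) (Mu O.merged)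
        ((fcellsA κ Φ t p O.merged (gOf κ Φ t p O (KS.gT 0 gx)) (fOf κ Φ t p O (KS.fT 0 fx))).farCore x du j (3 : ℤ)) (targetMM G (φL κ Φ t p O.D O.DT O.ori (gOf κ Φ t p O (KS.gT 0 gx)) (fOf κ Φ t p O (KS.fT 0 fx))) (prFA κ Φ t p O.merged (gOf κ Φ t p O (KS.gT 0 gx)) (fOf κ Φ t p O (KS.fT 0 fx))) (fcellsA κ Φ t p O.merged (gOf κ Φ t p O (KS.gT 0 gx)) (fOf κ Φ t p O (KS.fT 0 fx))) t (concRadii2N (fcellsA κ Φ t p O.merged (gOf κ Φ t p O (KS.gT 0 gx)) (fOf κ Φ t p O (KS.fT 0 fx))) (Skelφ.Prm.gap ((SUA ex mx) κ Φ t p O.merged (gOf κ Φ t p O (KS.gT 0 gx)) (fOf κ Φ t p O (KS.fT 0 fx)) q)) (fun _ : ℕ => (0:ℕ)) (Skelφ.Prm.E₀ ((SUA ex mx) κ Φ t p O.merged (gOf κ Φ t p O (KS.gT 0 gx)) (fOf κ Φ t p O (KS.fT 0 fx)) q)) (Skelφ.Prm.Lp ((SUA ex mx) κ Φ t p O.merged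 (gOf κ Φ t p O (KS.gT 0 gx)) (fOf κ Φ t p O (KS.fT 0 fx)) q)) (offNA κ Φ t p O.merged (gOf κ Φ t p O (KS.gT 0 gx)) (fOf κ Φ t p O (KS.fT 0 fx)))) (b0TA κ Φ t p O.merged (gOf κ Φ t p O (KS.gT 0 gx)) (fOf κ Φ t p O (KS.fT 0 fx))) a' x du (Skelφ.Prm.Lp ((SUA ex mx) κ Φ t p O.merged (gOf κ Φ t p O (KS.gT 0 gx)) (fOf κ Φ t p O (KS.fT 0 fx)) q))) (O.merged.Λ c' (Mu O.merged)) (Skelφ.Prm.Lp (SUA ex mx κ Φ t p O.merged (gOf κ Φ t p O (KS.gT 0 gx)) (fOf κ Φ t p O (KS.fT 0 fx)) q)) ((fun i : Fin 2 => if i = 0 then KS.kF₀A κ Φ t p O.merged cF 0 (gOf κ Φ t p O (KS.gT 0 gx)) (fOf κ Φ t p O (KS.fT 0 fx)) else KS.kF₁A κ Φ t p O.merged cF 0 (gOf κ Φ t p O (KS.gT 0 gx)) (fOf κ Φ t p O (KS.fT 0 fx))) du.1) ((fun i : Fin 2 => if i = 0 then KS.kF₀A κ Φ t p O.merged cF 0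 (gOf κ Φ t p O (KS.gT 0 gx)) (fOf κ Φ t p O (KS.fT 0 fx)) else KS.kF₁A κ Φ t p O.merged cF 0 (gOf κ Φ t p O (KS.gT 0 gx)) (fOf κ Φ t p O (KS.fT 0 fx))) (oth du.1)))
    (numsY : ∀ (a' : ℕ) (x : Site 2) (du : MDir) (j : ℕ) (pc : ℤ) (c' : V), du.1 = 1 → j < (fcellsA κ Φ t p O.merged (gOf κ Φ t p O (KS.gT 0 gx)) (fOf κ Φ t p O (KS.fT 0 fx))).K → ∀ yF : V,
      (prFA κ Φ t p O.merged (gOf κ Φ t p O (KS.gT 0 gx)) (fOf κ Φ t p O (KS.fT 0 fx))).ψ (φL κ Φ t p O.D O.DT O.ori (gOf κ Φ t p O (KS.gT 0 gx)) (fOf κ Φ t p O (KS.fT 0 fx))) t yF = (fcellsA κ Φ t p O.merged (gOf κ Φ t p O (KS.gT 0 gx)) (fOf κ Φ t p O (KS.fT 0 fx))).faceCen x du j → pc = relφ (φL κ Φ t p O.D O.DT O.ori (gOf κ Φ t p O (KS.gT 0 gx)) (fOf κ Φ t p O (KS.fT 0 fx))) t yF ((prFA κ Φ t p O.merged (gOf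 κ Φ t p O (KS.gT 0 gx)) (fOf κ Φ t p O (KS.fT 0 fx))).bOf du.1) →
      (prFA κ Φ t p O.merged (gOf κ Φ t p O (KS.gT 0 gx)) (fOf κ Φ t p O (KS.fT 0 fx))).frame (φL κ Φ t p O.D O.DT O.ori (gOf κ Φ t p O (KS.gT 0 gx)) (fOf κ Φ t p O (KS.fT 0 fx))) t du.1 ((prFA κ Φ t p O.merged (gOf κ Φ t p O (KS.gT 0 gx)) (fOf κ Φ t p O (KS.fT 0 fx))).bOf du.1) c' ∈ Finset.Icc (loN (fcellsA κ Φ t p O.merged (gOf κ Φ t p O (KS.gT 0 gx)) (fOf κ Φ t p O (KS.fT 0 fx))) x du j pc ((fun du : MDir => ((prFA κ Φ t p O.merged (gOf κ Φ t p O (KS.gT 0 gx)) (fOf κ Φ t p O (KS.fT 0 fx))).awF₂ (fcellsA κ Φ t p O.merged (gOf κ Φ t p O (KS.gT 0 gx)) (fOf κ Φ t p O (KS.fT 0 fx))) du).toNat) du) - (((KS.RlevA κ Φ t p O.merged 0 + KS.reachA t O.merged 0) : ℕ) : Site 2)) (hiN (fcellsA κ Φ t p O.merged (gOf κ Φ t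 p O (KS.gT 0 gx)) (fOf κ Φ t p O (KS.fT 0 fx))) x du j pc ((fun du : MDir => ((prFA κ Φ t p O.merged (gOf κ Φ t p O (KS.gT 0 gx)) (fOf κ Φ t p O (KS.fT 0 fx))).awF₂ (fcellsA κ Φ t p O.merged (gOf κ Φ t p O (KS.gT 0 gx)) (fOf κ Φ t p O (KS.fT 0 fx))) du).toNat) du) + (((KS.RlevA κ Φ t p O.merged 0 + KS.reachA t O.merged 0) : ℕ) : Site 2)) →
      c' ∈ graphBall G t ((concRadii2N (fcellsA κ Φ t p O.merged (gOf κ Φ t p O (KS.gT 0 gx)) (fOf κ Φ t p O (KS.fT 0 fx))) (Skelφ.Prm.gap ((SUA ex mx) κ Φ t p O.merged (gOf κ Φ t p O (KS.gT 0 gx)) (fOf κ Φ t p O (KS.fT 0 fx)) q)) (fun _ : ℕ => (0:ℕ)) (Skelφ.Prm.E₀ ((SUA ex mx) κ Φ t p O.merged (gOf κ Φ t p O (KS.gT 0 gx)) (fOf κ Φ t p O (KS.fT 0 fx)) q)) (Skelφ.Prm.Lp ((SUA ex mx) κ Φ t p O.merged (gOf κ Φ t p O (KS.gT 0 gx)) (fOf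 κ Φ t p O (KS.fT 0 fx)) q)) (offNA κ Φ t p O.merged (gOf κ Φ t p O (KS.gT 0 gx)) (fOf κ Φ t p O (KS.fT 0 fx)))).rE a' x du - (Skelφ.Prm.Lp (SUA ex mx κ Φ t p O.merged (gOf κ Φ t p O (KS.gT 0 gx)) (fOf κ Φ t p O (KS.fT 0 fx)) q))) →
      (Skelφ.Prm.Lp ((SUA ex mx) κ Φ t p O.merged (gOf κ Φ t p O (KS.gT 0 gx)) (fOf κ Φ t p O (KS.fT 0 fx)) q)) ≤ (concRadii2N (fcellsA κ Φ t p O.merged (gOf κ Φ t p O (KS.gT 0 gx)) (fOf κ Φ t p O (KS.fT 0 fx))) (Skelφ.Prm.gap ((SUA ex mx) κ Φ t p O.merged (gOf κ Φ t p O (KS.gT 0 gx)) (fOf κ Φ t p O (KS.fT 0 fx)) q)) (fun _ : ℕ => (0:ℕ)) (Skelφ.Prm.E₀ ((SUA ex mx) κ Φ t p O.merged (gOf κ Φ t p O (KS.gT 0 gx)) (fOf κ Φ t p O (KS.fT 0 fx)) q)) (Skelφ.Prm.Lp ((SUA ex mx) κ Φ t p O.merged (gOf κ Φ t p O (KS.gT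 0 gx)) (fOf κ Φ t p O (KS.fT 0 fx)) q)) (offNA κ Φ t p O.merged (gOf κ Φ t p O (KS.gT 0 gx)) (fOf κ Φ t p O (KS.fT 0 fx)))).rM a' (x + stepVec du) → (Skelφ.Prm.Lp (SUA ex mx κ Φ t p O.merged (gOf κ Φ t p O (KS.gT 0 gx)) (fOf κ Φ t p O (KS.fT 0 fx)) q)) ≤ (concRadii2N (fcellsA κ Φ t p O.merged (gOf κ Φ t p O (KS.gT 0 gx)) (fOf κ Φ t p O (KS.fT 0 fx))) (Skelφ.Prm.gap ((SUA ex mx) κ Φ t p O.merged (gOf κ Φ t p O (KS.gT 0 gx)) (fOf κ Φ t p O (KS.fT 0 fx)) q)) (fun _ : ℕ => (0:ℕ)) (Skelφ.Prm.E₀ ((SUA ex mx) κ Φ t p O.merged (gOf κ Φ t p O (KS.gT 0 gx)) (fOf κ Φ t p O (KS.fT 0 fx)) q)) (Skelφ.Prm.Lp ((SUA ex mx) κ Φ t p O.merged (gOf κ Φ t p O (KS.gT 0 gx)) (fOf κ Φ t p O (KS.fT 0 fx)) q)) (offNA κ Φ t p O.merged (gOf κ Φ t p O (KS.gT 0 gx))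 (fOf κ Φ t p O (KS.fT 0 fx)))).rE a' x du →
      FaceRunNumsY4 G (φL κ Φ t p O.D O.DT O.ori (gOf κ Φ t p O (KS.gT 0 gx)) (fOf κ Φ t p O (KS.fT 0 fx))) ((prFA κ Φ t p O.merged (gOf κ Φ t p O (KS.gT 0 gx)) (fOf κ Φ t p O (KS.fT 0 fx))).ψ (φL κ Φ t p O.D O.DT O.ori (gOf κ Φ t p O (KS.gT 0 gx)) (fOf κ Φ t p O (KS.fT 0 fx))) t) c' (prFA κ Φ t p O.merged (gOf κ Φ t p O (KS.gT 0 gx)) (fOf κ Φ t p O (KS.fT 0 fx))).A (nL κ Φ t p O.merged (gOf κ Φ t p O (KS.gT 0 gx)) (fOf κ Φ t p O (KS.fT 0 fx))) (prFA κ Φ t p O.merged (gOf κ Φ t p O (KS.gT 0 gx)) (fOf κ Φ t p O (KS.fT 0 fx))).h (prFA κ Φ t p O.merged (gOf κ Φ t p O (KS.gT 0 gx)) (fOf κ Φ t p O (KS.fT 0 fx))).vα (prFA κ Φ t p O.merged (gOf κ Φ t p O (KS.gT 0 gx)) (fOf κ Φ t p O (KS.fT 0 fx))).vβ (prFA κ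 Φ t p O.merged (gOf κ Φ t p O (KS.gT 0 gx)) (fOf κ Φ t p O (KS.fT 0 fx))).c₀ (prFA κ Φ t p O.merged (gOf κ Φ t p O (KS.gT 0 gx)) (fOf κ Φ t p O (KS.fT 0 fx))).c₁ (prFA κ Φ t p O.merged (gOf κ Φ t p O (KS.gT 0 gx)) (fOf κ Φ t p O (KS.fT 0 fx))).D du (σhF du) (sgOf du) ((fun σ' : ℤ => KS.BFt κ Φ t p O.merged cF 0 (gOf κ Φ t p O (KS.gT 0 gx)) (fOf κ Φ t p O (KS.fT 0 fx)) σ') (σhF du)) (ℓL κ Φ t p O.merged (gOf κ Φ t p O (KS.gT 0 gx)) (fOf κ Φ t p O (KS.fT 0 fx))) (KS.RA' κ Φ t p O.merged 0) qB' (KS.RA' κ Φ t p O.merged 0) qB₃' (prFA κ Φ t p O.merged (gOf κ Φ t p O (KS.gT 0 gx)) (fOf κ Φ t p O (KS.fT 0 fx))).vα (one_le_nL_of_atQOS (atQOS_of_atQOTA hAt)) (abs_vL_le_of_atQOS (atQOS_of_atQOTA hAt))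
        (layer_of_atQOS (atQOS_of_atQOTA hAt)) (Mu O.merged) ((fcellsA κ Φ t p O.merged (gOf κ Φ t p O (KS.gT 0 gx)) (fOf κ Φ t p O (KS.fT 0 fx))).farCore x du j (3 : ℤ)) (targetMM G (φL κ Φ t p O.D O.DT O.ori (gOf κ Φ t p O (KS.gT 0 gx)) (fOf κ Φ t p O (KS.fT 0 fx))) (prFA κ Φ t p O.merged (gOf κ Φ t p O (KS.gT 0 gx)) (fOf κ Φ t p O (KS.fT 0 fx))) (fcellsA κ Φ t p O.merged (gOf κ Φ t p O (KS.gT 0 gx)) (fOf κ Φ t p O (KS.fT 0 fx))) t (concRadii2N (fcellsA κ Φ t p O.merged (gOf κ Φ t p O (KS.gT 0 gx)) (fOf κ Φ t p O (KS.fT 0 fx))) (Skelφ.Prm.gap ((SUA ex mx) κ Φ t p O.merged (gOf κ Φ t p O (KS.gT 0 gx)) (fOf κ Φ t p O (KS.fT 0 fx)) q)) (fun _ : ℕ => (0:ℕ)) (Skelφ.Prm.E₀ ((SUA ex mx) κ Φ t p O.merged (gOf κ Φ t p O (KS.gT 0 gx)) (fOf κ Φ t p O (KS.fT 0 fx)) q))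 (Skelφ.Prm.Lp ((SUA ex mx) κ Φ t p O.merged (gOf κ Φ t p O (KS.gT 0 gx)) (fOf κ Φ t p O (KS.fT 0 fx)) q)) (offNA κ Φ t p O.merged (gOf κ Φ t p O (KS.gT 0 gx)) (fOf κ Φ t p O (KS.fT 0 fx)))) (b0TA κ Φ t p O.merged (gOf κ Φ t p O (KS.gT 0 gx)) (fOf κ Φ t p O (KS.fT 0 fx))) a' x du (Skelφ.Prm.Lp ((SUA ex mx) κ Φ t p O.merged (gOf κ Φ t p O (KS.gT 0 gx)) (fOf κ Φ t p O (KS.fT 0 fx)) q))) (O.merged.Λ c' (Mu O.merged)) (Skelφ.Prm.Lp (SUA ex mx κ Φ t p O.merged (gOf κ Φ t p O (KS.gT 0 gx)) (fOf κ Φ t p O (KS.fT 0 fx)) q)) ((fun i : Fin 2 => if i = 0 then KS.kF₀A κ Φ t p O.merged cF 0 (gOf κ Φ t p O (KS.gT 0 gx)) (fOf κ Φ t p O (KS.fT 0 fx)) else KS.kF₁A κ Φ t p O.merged cF 0 (gOf κ Φ t p O (KS.gT 0 gx)) (fOf κ Φ t p O (KS.fT 0 fx))) du.1) ((fun i : Fin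 2 => if i = 0 then KS.kF₀A κ Φ t p O.merged cF 0 (gOf κ Φ t p O (KS.gT 0 gx)) (fOf κ Φ t p O (KS.fT 0 fx)) else KS.kF₁A κ Φ t p O.merged cF 0 (gOf κ Φ t p O (KS.gT 0 gx)) (fOf κ Φ t p O (KS.fT 0 fx))) (oth du.1)))
    (hnFx : ∀ (a' : ℕ) (x : Site 2) (du : MDir) (j : ℕ) (pc : ℤ) (c' : V) (hI : du.1 = 0) (hj : j < (fcellsA κ Φ t p O.merged (gOf κ Φ t p O (KS.gT 0 gx)) (fOf κ Φ t p O (KS.fT 0 fx))).K) (yF : V)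
      (hyF : (prFA κ Φ t p O.merged (gOf κ Φ t p O (KS.gT 0 gx)) (fOf κ Φ t p O (KS.fT 0 fx))).ψ (φL κ Φ t p O.D O.DT O.ori (gOf κ Φ t p O (KS.gT 0 gx)) (fOf κ Φ t p O (KS.fT 0 fx))) t yF = (fcellsA κ Φ t p O.merged (gOf κ Φ t p O (KS.gT 0 gx)) (fOf κ Φ t p O (KS.fT 0 fx))).faceCen x du j) (hpc : pc = relφ (φL κ Φ t p O.D O.DT O.ori (gOf κ Φ t p O (KS.gT 0 gx)) (fOf κ Φ t p O (KS.fT 0 fx))) t yF ((prFA κ Φ t p O.merged (gOf κ Φ t p O (KS.gT 0 gx)) (fOf κ Φ t p O (KS.fT 0 fx))).bOf du.1))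
      (h1 : (prFA κ Φ t p O.merged (gOf κ Φ t p O (KS.gT 0 gx)) (fOf κ Φ t p O (KS.fT 0 fx))).frame (φL κ Φ t p O.D O.DT O.ori (gOf κ Φ t p O (KS.gT 0 gx)) (fOf κ Φ t p O (KS.fT 0 fx))) t du.1 ((prFA κ Φ t p O.merged (gOf κ Φ t p O (KS.gT 0 gx)) (fOf κ Φ t p O (KS.fT 0 fx))).bOf du.1) c' ∈ Finset.Icc (loN (fcellsA κ Φ t p O.merged (gOf κ Φ t p O (KS.gT 0 gx)) (fOf κ Φ t p O (KS.fT 0 fx))) x du j pc ((fun du : MDir => ((prFA κ Φ t p O.merged (gOf κ Φ t p O (KS.gT 0 gx)) (fOf κ Φ t p O (KS.fT 0 fx))).awF₂ (fcellsA κ Φ t p O.merged (gOf κ Φ t p O (KS.gT 0 gx)) (fOf κ Φ t p O (KS.fT 0 fx))) du).toNat) du) - (((KS.RlevA κ Φ t p O.merged 0 + KS.reachA t O.merged 0) : ℕ) : Site 2)) (hiN (fcellsA κ Φ t p O.merged (gOf κ Φ t p O (KS.gT 0 gx)) (fOf κ Φ t p O (KS.fT 0 fx))) x du j pc ((fun du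 : MDir => ((prFA κ Φ t p O.merged (gOf κ Φ t p O (KS.gT 0 gx)) (fOf κ Φ t p O (KS.fT 0 fx))).awF₂ (fcellsA κ Φ t p O.merged (gOf κ Φ t p O (KS.gT 0 gx)) (fOf κ Φ t p O (KS.fT 0 fx))) du).toNat) du) + (((KS.RlevA κ Φ t p O.merged 0 + KS.reachA t O.merged 0) : ℕ) : Site 2)))
      (h2 : c' ∈ graphBall G t ((concRadii2N (fcellsA κ Φ t p O.merged (gOf κ Φ t p O (KS.gT 0 gx)) (fOf κ Φ t p O (KS.fT 0 fx))) (Skelφ.Prm.gap ((SUA ex mx) κ Φ t p O.merged (gOf κ Φ t p O (KS.gT 0 gx)) (fOf κ Φ t p O (KS.fT 0 fx)) q)) (fun _ : ℕ => (0:ℕ)) (Skelφ.Prm.E₀ ((SUA ex mx) κ Φ t p O.merged (gOf κ Φ t p O (KS.gT 0 gx)) (fOf κ Φ t p O (KS.fT 0 fx)) q)) (Skelφ.Prm.Lp ((SUA ex mx) κ Φ t p O.merged (gOf κ Φ t p O (KS.gT 0 gx)) (fOf κ Φ t p O (KS.fT 0 fx)) q)) (offNA κ Φ t p O.merged (gOf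 κ Φ t p O (KS.gT 0 gx)) (fOf κ Φ t p O (KS.fT 0 fx)))).rE a' x du - (Skelφ.Prm.Lp (SUA ex mx κ Φ t p O.merged (gOf κ Φ t p O (KS.gT 0 gx)) (fOf κ Φ t p O (KS.fT 0 fx)) q))))
      (hM : (Skelφ.Prm.Lp ((SUA ex mx) κ Φ t p O.merged (gOf κ Φ t p O (KS.gT 0 gx)) (fOf κ Φ t p O (KS.fT 0 fx)) q)) ≤ (concRadii2N (fcellsA κ Φ t p O.merged (gOf κ Φ t p O (KS.gT 0 gx)) (fOf κ Φ t p O (KS.fT 0 fx))) (Skelφ.Prm.gap ((SUA ex mx) κ Φ t p O.merged (gOf κ Φ t p O (KS.gT 0 gx)) (fOf κ Φ t p O (KS.fT 0 fx)) q)) (fun _ : ℕ => (0:ℕ)) (Skelφ.Prm.E₀ ((SUA ex mx) κ Φ t p O.merged (gOf κ Φ t p O (KS.gT 0 gx)) (fOf κ Φ t p O (KS.fT 0 fx)) q)) (Skelφ.Prm.Lp ((SUA ex mx) κ Φ t p O.merged (gOf κ Φ t p O (KS.gT 0 gx)) (fOf κ Φ t p O (KS.fT 0 fx)) q)) (offNA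 κ Φ t p O.merged (gOf κ Φ t p O (KS.gT 0 gx)) (fOf κ Φ t p O (KS.fT 0 fx)))).rM a' (x + stepVec du)) (hE : (Skelφ.Prm.Lp (SUA ex mx κ Φ t p O.merged (gOf κ Φ t p O (KS.gT 0 gx)) (fOf κ Φ t p O (KS.fT 0 fx)) q)) ≤ (concRadii2N (fcellsA κ Φ t p O.merged (gOf κ Φ t p O (KS.gT 0 gx)) (fOf κ Φ t p O (KS.fT 0 fx))) (Skelφ.Prm.gap ((SUA ex mx) κ Φ t p O.merged (gOf κ Φ t p O (KS.gT 0 gx)) (fOf κ Φ t p O (KS.fT 0 fx)) q)) (fun _ : ℕ => (0:ℕ)) (Skelφ.Prm.E₀ ((SUA ex mx) κ Φ t p O.merged (gOf κ Φ t p O (KS.gT 0 gx)) (fOf κ Φ t p O (KS.fT 0 fx)) q)) (Skelφ.Prm.Lp ((SUA ex mx) κ Φ t p O.merged (gOf κ Φ t p O (KS.gT 0 gx)) (fOf κ Φ t p O (KS.fT 0 fx)) q)) (offNA κ Φ t p O.merged (gOf κ Φ t p O (KS.gT 0 gx)) (fOf κ Φ t p O (KS.fT 0 fx)))).rE a' x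 du),
      0 + 1 + (numsX a' x du j pc c' hI hj yF hyF hpc h1 h2 hM hE).Nr + 1 + (numsX a' x du j pc c' hI hj yF hyF hpc h1 h2 hM hE).N₃ ≤ (NegB.nFA κ.K₀))
    (hnFy : ∀ (a' : ℕ) (x : Site 2) (du : MDir) (j : ℕ) (pc : ℤ) (c' : V) (hI : du.1 = 1) (hj : j < (fcellsA κ Φ t p O.merged (gOf κ Φ t p O (KS.gT 0 gx)) (fOf κ Φ t p O (KS.fT 0 fx))).K) (yF : V)
      (hyF : (prFA κ Φ t p O.merged (gOf κ Φ t p O (KS.gT 0 gx)) (fOf κ Φ t p O (KS.fT 0 fx))).ψ (φL κ Φ t p O.D O.DT O.ori (gOf κ Φ t p O (KS.gT 0 gx)) (fOf κ Φ t p O (KS.fT 0 fx))) t yF = (fcellsA κ Φ t p O.merged (gOf κ Φ t p O (KS.gT 0 gx)) (fOf κ Φ t p O (KS.fT 0 fx))).faceCen x du j) (hpc : pc = relφ (φL κ Φ t p O.D O.DT O.ori (gOf κ Φ t p O (KS.gT 0 gx)) (fOf κ Φ t p O (KS.fT 0 fx))) t yF ((prFA κ Φ t p O.merged (gOf κ Φ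 t p O (KS.gT 0 gx)) (fOf κ Φ t p O (KS.fT 0 fx))).bOf du.1))
      (h1 : (prFA κ Φ t p O.merged (gOf κ Φ t p O (KS.gT 0 gx)) (fOf κ Φ t p O (KS.fT 0 fx))).frame (φL κ Φ t p O.D O.DT O.ori (gOf κ Φ t p O (KS.gT 0 gx)) (fOf κ Φ t p O (KS.fT 0 fx))) t du.1 ((prFA κ Φ t p O.merged (gOf κ Φ t p O (KS.gT 0 gx)) (fOf κ Φ t p O (KS.fT 0 fx))).bOf du.1) c' ∈ Finset.Icc (loN (fcellsA κ Φ t p O.merged (gOf κ Φ t p O (KS.gT 0 gx)) (fOf κ Φ t p O (KS.fT 0 fx))) x du j pc ((fun du : MDir => ((prFA κ Φ t p O.merged (gOf κ Φ t p O (KS.gT 0 gx)) (fOf κ Φ t p O (KS.fT 0 fx))).awF₂ (fcellsA κ Φ t p O.merged (gOf κ Φ t p O (KS.gT 0 gx)) (fOf κ Φ t p O (KS.fT 0 fx))) du).toNat) du) - (((KS.RlevA κ Φ t p O.merged 0 + KS.reachA t O.merged 0) : ℕ) : Site 2)) (hiN (fcellsA κ Φ t p O.merged (gOf κ Φ t p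 O (KS.gT 0 gx)) (fOf κ Φ t p O (KS.fT 0 fx))) x du j pc ((fun du : MDir => ((prFA κ Φ t p O.merged (gOf κ Φ t p O (KS.gT 0 gx)) (fOf κ Φ t p O (KS.fT 0 fx))).awF₂ (fcellsA κ Φ t p O.merged (gOf κ Φ t p O (KS.gT 0 gx)) (fOf κ Φ t p O (KS.fT 0 fx))) du).toNat) du) + (((KS.RlevA κ Φ t p O.merged 0 + KS.reachA t O.merged 0) : ℕ) : Site 2)))
      (h2 : c' ∈ graphBall G t ((concRadii2N (fcellsA κ Φ t p O.merged (gOf κ Φ t p O (KS.gT 0 gx)) (fOf κ Φ t p O (KS.fT 0 fx))) (Skelφ.Prm.gap ((SUA ex mx) κ Φ t p O.merged (gOf κ Φ t p O (KS.gT 0 gx)) (fOf κ Φ t p O (KS.fT 0 fx)) q)) (fun _ : ℕ => (0:ℕ)) (Skelφ.Prm.E₀ ((SUA ex mx) κ Φ t p O.merged (gOf κ Φ t p O (KS.gT 0 gx)) (fOf κ Φ t p O (KS.fT 0 fx)) q)) (Skelφ.Prm.Lp ((SUA ex mx) κ Φ t p O.merged (gOf κ Φ t p O (KS.gT 0 gx))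 (fOf κ Φ t p O (KS.fT 0 fx)) q)) (offNA κ Φ t p O.merged (gOf κ Φ t p O (KS.gT 0 gx)) (fOf κ Φ t p O (KS.fT 0 fx)))).rE a' x du - (Skelφ.Prm.Lp (SUA ex mx κ Φ t p O.merged (gOf κ Φ t p O (KS.gT 0 gx)) (fOf κ Φ t p O (KS.fT 0 fx)) q))))
      (hM : (Skelφ.Prm.Lp ((SUA ex mx) κ Φ t p O.merged (gOf κ Φ t p O (KS.gT 0 gx)) (fOf κ Φ t p O (KS.fT 0 fx)) q)) ≤ (concRadii2N (fcellsA κ Φ t p O.merged (gOf κ Φ t p O (KS.gT 0 gx)) (fOf κ Φ t p O (KS.fT 0 fx))) (Skelφ.Prm.gap ((SUA ex mx) κ Φ t p O.merged (gOf κ Φ t p O (KS.gT 0 gx)) (fOf κ Φ t p O (KS.fT 0 fx)) q)) (fun _ : ℕ => (0:ℕ)) (Skelφ.Prm.E₀ ((SUA ex mx) κ Φ t p O.merged (gOf κ Φ t p O (KS.gT 0 gx)) (fOf κ Φ t p O (KS.fT 0 fx)) q)) (Skelφ.Prm.Lp ((SUA ex mx) κ Φ t p O.merged (gOf κ Φ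 t p O (KS.gT 0 gx)) (fOf κ Φ t p O (KS.fT 0 fx)) q)) (offNA κ Φ t p O.merged (gOf κ Φ t p O (KS.gT 0 gx)) (fOf κ Φ t p O (KS.fT 0 fx)))).rM a' (x + stepVec du)) (hE : (Skelφ.Prm.Lp (SUA ex mx κ Φ t p O.merged (gOf κ Φ t p O (KS.gT 0 gx)) (fOf κ Φ t p O (KS.fT 0 fx)) q)) ≤ (concRadii2N (fcellsA κ Φ t p O.merged (gOf κ Φ t p O (KS.gT 0 gx)) (fOf κ Φ t p O (KS.fT 0 fx))) (Skelφ.Prm.gap ((SUA ex mx) κ Φ t p O.merged (gOf κ Φ t p O (KS.gT 0 gx)) (fOf κ Φ t p O (KS.fT 0 fx)) q)) (fun _ : ℕ => (0:ℕ)) (Skelφ.Prm.E₀ ((SUA ex mx) κ Φ t p O.merged (gOf κ Φ t p O (KS.gT 0 gx)) (fOf κ Φ t p O (KS.fT 0 fx)) q)) (Skelφ.Prm.Lp ((SUA ex mx) κ Φ t p O.merged (gOf κ Φ t p O (KS.gT 0 gx)) (fOf κ Φ t p O (KS.fT 0 fx)) q)) (offNA κ Φ t p O.merged (gOf κ Φ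 t p O (KS.gT 0 gx)) (fOf κ Φ t p O (KS.fT 0 fx)))).rE a' x du),
      0 + 1 + (numsY a' x du j pc c' hI hj yF hyF hpc h1 h2 hM hE).Nr + 1 + (numsY a' x du j pc c' hI hj yF hyF hpc h1 h2 hM hE).N₃ ≤ (NegB.nFA κ.K₀)) :
    Skelφ.FaceOblRM G ((choiceAtOTA κ Φ t p (KS.gT 0 gx) (KS.fT 0 fx) (SUA ex mx) hC (KS.PR 0 Px)).scheme O q)
      ((choiceAtOTA κ Φ t p (KS.gT 0 gx) (KS.fT 0 fx) (SUA ex mx) hC (KS.PR 0 Px)).FD O q) Φ.Δ κ.δ₂ := by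
  -- facts at `AtQO`
  have hAtS := atQOS_of_atQOTA hAt
  have hAtB := atQOB_of_atQOTA hAt
  have hNL : EqNumL κ Φ t p O.merged (gOf κ Φ t p O (KS.gT 0 gx)) (fOf κ Φ t p O (KS.fT 0 fx)) := eqNumL_of_atQOTA hAt
  obtain ⟨hnL1, hℓL1⟩ := one_le_of_eqNumL κ Φ t p O.merged (gOf κ Φ t p O (KS.gT 0 gx)) (fOf κ Φ t p O (KS.fT 0 fx)) hNL
  obtain ⟨hF, hq1, hq2, hCq⟩ := factsO_of_atQOTA hAt
  obtain ⟨-, -, hkM₀, hReq, hΛeq⟩ := hF.seed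
  have hκ10 : (hL κ Φ t p O.merged (gOf κ Φ t p O (KS.gT 0 gx)) (fOf κ Φ t p O (KS.fT 0 fx))).natAbs ≤ 10 * nL κ Φ t p O.merged (gOf κ Φ t p O (KS.gT 0 gx)) (fOf κ Φ t p O (KS.fT 0 fx)) := (clauseL_of_atQOTA hAt).2
  have hRA := KS.RA'_eq κ Φ t p O.merged 0
  have hZ : ∀ c, (↑(O.merged.Λ c (Mu O.merged)) : Set V) ⊆ Skelφ.cyl (φL κ Φ t p O.D O.DT O.ori (gOf κ Φ t p O (KS.gT 0 gx)) (fOf κ Φ t p O (KS.fT 0 fx))) c (Mu O.merged) := fun c => by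
    unfold NegB.φL; rw [Skelφ.cyl_oriφ, hΛeq]; exact Skelφ.fatSeq_subset_cyl Φ.frame hC c _
  -- the F pair: clause, numbers, lengths
  have hEF := clauseB_of_factsO Φ t O.D O.DT O.ori (KS.mbF κ Φ t p O.merged cF 0) (KS.bF κ Φ t p O.merged cF 0) hAtS.1.shared.2.2.1 hAtS.1.clauses
  have hκb : (KS.hBF κ Φ t p O.merged cF 0).natAbs ≤ 10 * KS.nBF κ Φ t p O.merged cF 0 := hEF.2
  obtain ⟨-, -, -, hlayb0⟩ := eqNumB_of_eqGeom t O.merged (KS.mbF κ Φ t p O.merged cF 0) (KS.bF κ Φ t p O.merged cF 0) _ hEF.1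
  have hlayb : ((KS.MBF κ Φ t p O.merged cF 0 : ℤ) + 1) * ((KS.nBF κ Φ t p O.merged cF 0 : ℤ) + |KS.hBF κ Φ t p O.merged cF 0|) ≤
      (KS.nBF κ Φ t p O.merged cF 0 : ℤ) * ((KS.ℓBF κ Φ t p O.merged cF 0 : ℤ) + 1) := hlayb0
  have hℓ27 : 27 ≤ KS.ℓBF κ Φ t p O.merged cF 0 := by have h := KS.ℓBF_ge κ Φ t p O.merged cF 0 _ hEF.1; omega
  have hℓ3 : 3 ≤ KS.ℓBF κ Φ t p O.merged cF 0 := by omega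
  have hMBf := KS.MBF_floors κ Φ t p O.merged cF 0
  have hRF := KS.RF2F κ Φ t p O.merged cF 0
  have hnb : 1 ≤ KS.nBF κ Φ t p O.merged cF 0 := by have := hRF.2.1; omega
  have hMzb : Mu O.merged < KS.nBF κ Φ t p O.merged cF 0 := lt_of_le_of_lt hMBf.2.2 hRF.2.1
  have hclrb : (Mu O.merged + 4) * (KS.nBF κ Φ t p O.merged cF 0 + (KS.hBF κ Φ t p O.merged cF 0).natAbs) ≤
      KS.nBF κ Φ t p O.merged cF 0 * (KS.ℓBF κ Φ t p O.merged cF 0 + 1) :=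
    bridge_clr_aux _ _ _ _ _ (by have := hMBf.2.1; omega) hlayb
  -- the F pair's pieces at every centre, served for `P_q` (both families, all signs), at accuracy `δkit²`
  have hPbF := hPx
  have hδI2 : Neg.δI κ Φ ≤ Neg.δkit κ Φ ^ 2 := Neg.δI_le_sq_of_le κ Φ le_rfl
  have hservedB : ∀ (c : V) (σ' τ' : ℤ), (σ' = 1 ∨ σ' = -1) → (τ' = 1 ∨ τ' = -1) →
      1 - Neg.δkit κ Φ ^ 2 < (bondPercolation G q).real (linkIn
        (Skelφ.pgramPrism G (oriφ Φ.φ (O.ori t (KS.MBF κ Φ t p O.merged cF 0) (KS.nBF κ Φ t p O.merged cF 0))) c (KS.nBF κ Φ t p O.merged cF 0) (KS.hBF κ Φ t p O.merged cF 0)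
          (3 * KS.ℓBF κ Φ t p O.merged cF 0) (O.merged.R (O.merged.scale t (KS.MBF κ Φ t p O.merged cF 0) (KS.nBF κ Φ t p O.merged cF 0)))) (O.merged.Λ c O.merged.k)
        (pgSideHalfW G (oriφ Φ.φ (O.ori t (KS.MBF κ Φ t p O.merged cF 0) (KS.nBF κ Φ t p O.merged cF 0))) c (KS.nBF κ Φ t p O.merged cF 0) (KS.hBF κ Φ t p O.merged cF 0)
          (KS.ℓBF κ Φ t p O.merged cF 0) (O.merged.R (O.merged.scale t (KS.MBF κ Φ t p O.merged cF 0) (KS.nBF κ Φ t p O.merged cF 0))) σ' τ')) ∧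
      1 - Neg.δkit κ Φ ^ 2 < (bondPercolation G q).real (linkIn
        (Skelφ.pgramPrism G (oriφ Φ.φ (O.ori t (KS.MBF κ Φ t p O.merged cF 0) (KS.nBF κ Φ t p O.merged cF 0))) c (KS.nBF κ Φ t p O.merged cF 0) (KS.hBF κ Φ t p O.merged cF 0)
          (3 * KS.ℓBF κ Φ t p O.merged cF 0) (O.merged.R (O.merged.scale t (KS.MBF κ Φ t p O.merged cF 0) (KS.nBF κ Φ t p O.merged cF 0)))) (O.merged.Λ c O.merged.k)
        (pgTopPieceW G (oriφ Φ.φ (O.ori t (KS.MBF κ Φ t p O.merged cF 0) (KS.nBF κ Φ t p O.merged cF 0))) c (KS.nBF κ Φ t p O.merged cF 0) (KS.hBF κ Φ t p O.merged cF 0)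
          (KS.ℓBF κ Φ t p O.merged cF 0) (O.merged.R (O.merged.scale t (KS.MBF κ Φ t p O.merged cF 0) (KS.nBF κ Φ t p O.merged cF 0))) σ' τ' (KS.vBF κ Φ t p O.merged cF 0))) := by
    intro c σ' τ' hσ' hτ'
    have ha := inputsExtraAt_of_atQOB hAtB h1 c hPbF 0 (Skelφ.sgnU σ') (Skelφ.sgnU τ')
    have hb := inputsExtraAt_of_atQOB hAtB h1 c hPbF 1 (Skelφ.sgnU σ') (Skelφ.sgnU τ')
    rw [Skelφ.StepI.eventNAt_some] at ha hb
    unfold Skelφ.StepI.regionNAt Skelφ.StepI.pieceNAt at ha hb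
    rw [if_pos rfl, Skelφ.val_sgnU hσ', Skelφ.val_sgnU hτ'] at ha
    rw [if_neg (by decide), Skelφ.val_sgnU hσ', Skelφ.val_sgnU hτ'] at hb
    exact ⟨lt_of_le_of_lt (by linarith [hδI2]) ha, lt_of_le_of_lt (by linarith [hδI2]) hb⟩
  -- the long numbers and the F-Λ block
  have HNL := one_le_nL_of_atQOS hAtS
  have HVL := abs_vL_le_of_atQOS hAtS
  have HLAY := layer_of_atQOS hAtS
  have hKC : 11 * Mu O.merged ≤ KS.reachA t O.merged 0 := by unfold KS.reachA KS.KCmax; omega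
  have hMe : ((Mu O.merged : ℕ) : ℤ) ≤ (KS.eF κ Φ t p O.merged cF 0 : ℤ) := by
    have h : Mu O.merged ≤ KS.eF κ Φ t p O.merged cF 0 := by unfold KS.eF; have := hRA.1; omega
    exact_mod_cast h
  have hΛZ2 := faceLam_zone κ Φ t p O.merged cF 0 (gOf κ Φ t p O (KS.gT 0 gx)) (fOf κ Φ t p O (KS.fT 0 fx)) hNL hMe
  -- the radius facts for the bridge reach: `YbF ≤ L′`
  have hfl := floors_exA κ Φ t p O.merged (gOf κ Φ t p O (KS.gT 0 gx)) (fOf κ Φ t p O (KS.fT 0 fx))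
  have hLp : (ex κ Φ t p O.merged (gOf κ Φ t p O (KS.gT 0 gx)) (fOf κ Φ t p O (KS.fT 0 fx))) ≤ (Skelφ.Prm.Lp (SUA ex mx κ Φ t p O.merged (gOf κ Φ t p O (KS.gT 0 gx)) (fOf κ Φ t p O (KS.fT 0 fx)) q)) := (ex_le_Lp_UA κ Φ t p O.merged (gOf κ Φ t p O (KS.gT 0 gx)) (fOf κ Φ t p O (KS.fT 0 fx)) ex mx q).1
  have hMLnL := (ML_lt_nL κ Φ t p O.merged (gOf κ Φ t p O (KS.gT 0 gx)) (fOf κ Φ t p O (KS.fT 0 fx))).1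
  have hSFn : KS.SF κ Φ t p O.merged cF 0 ≤ nL κ Φ t p O.merged (gOf κ Φ t p O (KS.gT 0 gx)) (fOf κ Φ t p O (KS.fT 0 fx)) := by have h := hSF16; omega
  have hRAn : KS.RA' κ Φ t p O.merged 0 ≤ nL κ Φ t p O.merged (gOf κ Φ t p O (KS.gT 0 gx)) (fOf κ Φ t p O (KS.fT 0 fx)) := by
    have h : KS.RA' κ Φ t p O.merged 0 + 2 ≤ nL κ Φ t p O.merged (gOf κ Φ t p O (KS.gT 0 gx)) (fOf κ Φ t p O (KS.fT 0 fx)) := (KS.nL_floorsT κ Φ t p O.merged 0 fx (gOf κ Φ t p O (KS.gT 0 gx))).2.2.2.2.1; omega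
  have hYb := KS.YbF_le_exA κ Φ t p O.merged cF 0 (gOf κ Φ t p O (KS.gT 0 gx)) (fOf κ Φ t p O (KS.fT 0 fx)) hκ10 hSFn hRAn hnL1
  have hYbLp : KS.YbF κ Φ t p O.merged cF 0 (gOf κ Φ t p O (KS.gT 0 gx)) (fOf κ Φ t p O (KS.fT 0 fx)) ≤ (Skelφ.Prm.Lp (SUA ex mx κ Φ t p O.merged (gOf κ Φ t p O (KS.gT 0 gx)) (fOf κ Φ t p O (KS.fT 0 fx)) q)) := by have := hex.1; omega
  have hBD := fun (c : V) {σ' : ℤ} (hσ' : σ' = 1 ∨ σ' = -1) =>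
    Skelφ.bridgeData_trTop c hσ' (nL κ Φ t p O.merged (gOf κ Φ t p O (KS.gT 0 gx)) (fOf κ Φ t p O (KS.fT 0 fx))) (hL κ Φ t p O.merged (gOf κ Φ t p O (KS.gT 0 gx)) (fOf κ Φ t p O (KS.fT 0 fx))) (ℓL κ Φ t p O.merged (gOf κ Φ t p O (KS.gT 0 gx)) (fOf κ Φ t p O (KS.fT 0 fx))) (KS.RA' κ Φ t p O.merged 0) hnb (KS.hBF κ Φ t p O.merged cF 0) (KS.ℓBF κ Φ t p O.merged cF 0) (O.merged.R (O.merged.scale t (KS.MBF κ Φ t p O.merged cF 0) (KS.nBF κ Φ t p O.merged cF 0))) (KS.vBF κ Φ t p O.merged cF 0) hZ hservedB htr hκb hclrb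
  exact faceOblRM_negBTC₂ (Λ₀ := (KS.ΛF₀ κ Φ t p O.merged cF 0 (gOf κ Φ t p O (KS.gT 0 gx)) (fOf κ Φ t p O (KS.fT 0 fx)))) (Λ₁ := (KS.ΛF₁ κ Φ t p O.merged cF 0 (gOf κ Φ t p O (KS.gT 0 gx)) (fOf κ Φ t p O (KS.fT 0 fx)))) (kA := (fun i : Fin 2 => if i = 0 then KS.kF₀A κ Φ t p O.merged cF 0 (gOf κ Φ t p O (KS.gT 0 gx)) (fOf κ Φ t p O (KS.fT 0 fx)) else KS.kF₁A κ Φ t p O.merged cF 0 (gOf κ Φ t p O (KS.gT 0 gx)) (fOf κ Φ t p O (KS.fT 0 fx)))) cF gx fx Px ex mx hAt hmx hex h1 hp0 hp1 (one_le_nL_of_atQOS (atQOS_of_atQOTA hAt)) (abs_vL_le_of_atQOS (atQOS_of_atQOTA hAt)) (fun σ' : ℤ => KS.BFt κ Φ t p O.merged cF 0 (gOf κ Φ t p O (KS.gT 0 gx)) (fOf κ Φ t p O (KS.fT 0 fx)) σ') (fun σ' hσ' => (KS.BF_ok κ Φ t p O.merged cF 0 (gOf κ Φ t p O (KS.gT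 0 gx)) (fOf κ Φ t p O (KS.fT 0 fx)) hσ' hℓ3).2.2) σhF hσhF qB qB₃ qB' qB₃' (layer_of_atQOS (atQOS_of_atQOTA hAt)) (fun σ' _ => (KS.BF_R'_ge κ Φ t p O.merged cF 0 (gOf κ Φ t p O (KS.gT 0 gx)) (fOf κ Φ t p O (KS.fT 0 fx)) σ').2.2) (fun σ' _ => (KS.hB0_F κ Φ t p O.merged cF 0 (gOf κ Φ t p O (KS.gT 0 gx)) (fOf κ Φ t p O (KS.fT 0 fx)) σ').2.2) (fun σ' hσ' => KS.hΛR_F κ Φ t p O.merged cF 0 (gOf κ Φ t p O (KS.gT 0 gx)) (fOf κ Φ t p O (KS.fT 0 fx)) hNL hσ') (KS.hΛQ_F κ Φ t p O.merged cF 0 (gOf κ Φ t p O (KS.gT 0 gx)) (fOf κ Φ t p O (KS.fT 0 fx))).1 (KS.hΛQ_F κ Φ t p O.merged cF 0 (gOf κ Φ t p O (KS.gT 0 gx)) (fOf κ Φ t p O (KS.fT 0 fx))).2 hΛZ2 (KS.hkF0_RA κ Φ t p O.merged cF 0 (gOf κ Φ t p O (KS.gT 0 gx)) (fOf κ Φ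 t p O (KS.fT 0 fx)) hNL) (KS.hkF1_RA κ Φ t p O.merged cF 0 (gOf κ Φ t p O (KS.gT 0 gx)) (fOf κ Φ t p O (KS.fT 0 fx)) hNL) (fun σ' hσ' => le_trans (KS.core1LoF_l1 κ Φ t p O.merged cF 0 (gOf κ Φ t p O (KS.gT 0 gx)) (fOf κ Φ t p O (KS.fT 0 fx)) hσ' hℓ27).2.2 hYbLp) (fun σ' _ => (KS.hclr₁_BF κ Φ t p O.merged cF 0 gx (fOf κ Φ t p O (KS.fT 0 fx)) hSF16 σ').2.2) hCF (fun σ' hσ' j hj _ => (rootKit_levels Φ t O.merged 0 _ _ ((KS.BF_ok κ Φ t p O.merged cF 0 (gOf κ Φ t p O (KS.gT 0 gx)) (fOf κ Φ t p O (KS.fT 0 fx)) hσ' hℓ3).2.2).h0 hj).1) (fun σ' hσ' j hj _ => (rootKit_levels Φ t O.merged 0 _ _ ((KS.BF_ok κ Φ t p O.merged cF 0 (gOf κ Φ t p O (KS.gT 0 gx)) (fOf κ Φ t p O (KS.fT 0 fx)) hσ' hℓ3).2.2).h0 hj).2.1) (fun σ' hσ' j hj _ => (rootKit_levels Φ t O.merged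 0 _ _ ((KS.BF_ok κ Φ t p O.merged cF 0 (gOf κ Φ t p O (KS.gT 0 gx)) (fOf κ Φ t p O (KS.fT 0 fx)) hσ' hℓ3).2.2).h0 hj).2.2) (fun σ' _ => le_trans (rootKit_reach κ Φ t p O.merged 0 _ _) (by rw [← hRA.2.1]; exact (KS.BF_R'_ge κ Φ t p O.merged cF 0 (gOf κ Φ t p O (KS.gT 0 gx)) (fOf κ Φ t p O (KS.fT 0 fx)) σ').2.2)) (fun (_ : ℤ) (c' : V) => pgramPrismFin G (trφ (φL κ Φ t p O.D O.DT O.ori (gOf κ Φ t p O (KS.gT 0 gx)) (fOf κ Φ t p O (KS.fT 0 fx)))) c' (KS.nBF κ Φ t p O.merged cF 0) (KS.hBF κ Φ t p O.merged cF 0) (3 * (KS.ℓBF κ Φ t p O.merged cF 0)) (O.merged.R (O.merged.scale t (KS.MBF κ Φ t p O.merged cF 0) (KS.nBF κ Φ t p O.merged cF 0)))) (fun (σ' : ℤ) (c' : V) => pgTopPieceW G (trφ (φL κ Φ t p O.D O.DT O.ori (gOf κ Φ t p O (KS.gT 0 gx)) (fOf κ Φ t p O (KS.fT 0 fx)))) c'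 (KS.nBF κ Φ t p O.merged cF 0) (KS.hBF κ Φ t p O.merged cF 0) (KS.ℓBF κ Φ t p O.merged cF 0) (O.merged.R (O.merged.scale t (KS.MBF κ Φ t p O.merged cF 0) (KS.nBF κ Φ t p O.merged cF 0))) σ' 1 (KS.vBF κ Φ t p O.merged cF 0)) (fun σ' hσ' c c' w hw => (hBD c hσ').1 c' w hw) (fun σ' hσ' c c' w hw => (hBD c hσ').2.1 c' w hw) (fun σ' hσ' c' => (hBD c' hσ').2.2.1 c') (fun σ' hσ' c' => (hBD c' hσ').2.2.2 c') numsX numsY hnFx hnFy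

end NegB

end PlanarSkeletonNeg

end Summit.CriticalPhenomena.PercolationContinuityZ3.Theorems.Transplant

end
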